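import Literature.NumberTheory.Rogawski1990.ArchChartOrbGBlockReduction      -- ★ p850417 (F0P3-p02 (g18)) (J-G′-BLOCK): `continuous_comp_symm_prodMk`, `hasCompactSupport_comp_symm_prodMk`; brings ★ (J-DESC) D4b `chartOrbG_eq_integral_descended_of_cutoff`, ★ (T-MEAS-G′), ★ `ArchHCSpaceG` (`hcCayPt`)
import Literature.NumberTheory.Automorphic.ArchRankOneSplitOrbitContinuity        -- ★ (A0-b) p850189 (F0P3a-p05 (g19)): `tendsto_abs_sub_smul_integral_descConj_hypBlockGL`, `hypBlockGL_mem_of_eq_over`, `hypBlockGL_mem_torusU`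
import Literature.NumberTheory.Automorphic.ArchRankOneSplitConeValuePos          -- ★ p850354∕p850366 (this seat): `smul_integral_prod_conj_hypBlockGL_comp_ne_zero_of_re_nonneg` (ED. 2 §4)
import Literature.MeasureTheory.Group.OrbitalDescentContinuousNonneg              -- ★ p850329 (this seat): `re_integral_conj_nonneg`, `im_integral_conj_eq_zero`, `re_integral_conj_pos_of_comm` (ED. 2 §4)
import HarnessLib

/-!
# (J-G′-BLOCK-β): the chart orbital functional `chartOrbG` of the CAYLEY chart `insert w S` along the `x`-ray IS `Kβ · Φβ(x)`, `Φβ` the rank-one SPLIT-torus quotient orbital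
# integral of the SAME block test function `f_B`, and `|eˣ − e⁻ˣ| · chartOrbG → Kβ · (C • cone(f_B))` as `x → 0⁺` — the `hray` binder of the (J-G′-SIDE) head
# (Rogawski 1990 §4.12 Lemma 4.12.1, §8.2 pp. 119–124; Shelstad 1979 Lemma 4.3; Varadarajan 1989 §6.4 Thm 23; Folland 1995 §2.6 (2.52))

Topic `NumberTheory/Rogawski1990`; namespace `Literature.NumberTheory.Rogawski1990`.  THEOREMS ONLY (no `def`, no instance, no notation, no axiom, no named fact, no `sorry`);
kernel lane `--kind proof --supports stmt-HodgeConjecture-24833`.  Cell `pub/hodgecm-mathlib`, crux H413 (`stmt-HodgeConjecture-24833`), F0∕P3c line LH3 (closer stub `stub_N9`,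
DIRECT ROAD `F0_P3c_StubN9Direct`, organ J `JumpAgreementStatement`): brick **(NONDEG-G′) ∕ (V2) = (J-G′-BLOCK-β)** (LH3-plan (g3) RULINGS #7 (a) 2026-09-02T08:03:50Z + 08:06:04Z «KEEP
(V2) + hΛ»; LH3-p02 (g3) 08:09:26Z ED. 2 interface: the binders `hray` ∕ `hΛ` of the G′-SIDE head ★ `ArchOrbFamGExtJumpSide`; seat F0P3b-p01 (g15)).  The SPLIT-SIDE TWIN of ★
`ArchChartOrbGBlockReduction` (p850417, F0P3-p02 (g18)): SAME wall point `s`, SAME cut-off `β`, SAME block equivalence `eM : Z(s) ≃ₜ* B × R` (now with `B = U(Φ₂)(ℂ)` in the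
antidiagonal frame of ★ (A0-b)), SAME spectator coordinate `r₀` — hence THE SAME block test function `f_B = (a′)_M^β ∘ eM⁻¹(·, r₀)` as on the compact side (organ J's ratio `cG = jump ∕
value` divides the two cone values of ONE `f_B`; cross-chart consistency is `rfl`).

THE MATHEMATICS.  On the Cayley chart `insert w S` (the wall place `w` now SPLIT) the torus `T′♯ = T_{insert w S} ∩ Z(s)` maps under `eM` to `A × R` with `A` the SPLIT torus of the
block (`torusU`, NON-compact), so the block reduction keeps the QUOTIENT `B ⧸ A`: for any measure `μ♯` on `Z(s) ⧸ T′♯` with `Ψβ_* μ♯ = κβ • μ` (`μ` the invariant measure on `B ⧸ A`),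
`∫_{Z(s)⧸T′♯} F(k γ k⁻¹) dμ♯ = κβ • ∫_{B⧸A} F(eM⁻¹(b γ_B b⁻¹, r)) dμ(ḃ)` (§1, change of variables along `Ψβ`, no Haar theory).  Along the `x`-ray
`ray x = hcCayPt w 0 2 p + x • e_{(w,0)}` ((V1-G′)'s token, LH4-p01 (g3)) the torus point `gprimeTorus (insert w S) (ray x)` has block component the split element
`γ_Bβ(x) = hypBlockGL x θ₀ = diag(e^{x+iθ₀}, e^{−x+iθ₀})` (`θ₀ = p w 0`) and FROZEN spectator `r₀` (`hγβ`), so ★ D4b (`chartOrbG = dt′(B′♯) · ∫_{Z(s)⧸T′♯} (a′)_M^β(k · gprimeTorus · k⁻¹)`,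
chart-generic) gives, for small `x > 0`,
  **`chartOrbG L α ν′ (insert w S) a′ (ray x) = (dt′(B′♯) · κβ) · ∫_{B⧸A} f_B(y · hypBlockGL x θ₀ · y⁻¹) dμ(ẏ)`** (§2),
and ★ (A0-b) `tendsto_abs_sub_smul_integral_descConj_hypBlockGL` at the FIXED `F := f_B` yields the `x`-RAY LIMIT OF THE NORMALISED SPLIT FUNCTIONAL
  **`|eˣ − e⁻ˣ| · chartOrbG L α ν′ (insert w S) a′ (ray x) ⟶ (dt′(B′♯) · κβ) · (C • ∫_{K×N} f_B(e^{iθ₀} · k n k⁻¹) d(κ ⊗ μ_N))`** as `x → 0⁺` (§3) — LH3-p02 (g3)'s `hray` with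
`Λ = Kβ · (C₂ · cone f_B)`, `Kβ := dt′(B′♯)·κβ`; `Λ ≠ 0` ((NONDEG-G′)) then follows from ★ `smul_integral_prod_conj_hypBlockGL_comp_ne_zero_of_re_nonneg` (p850366) for the
non-negative `a′` of ★ (N1′) and the positivity of `(a′)_M^β` at `s` (★ p850329 ∕ p850338), `dt′ > 0`, `κβ ≠ 0`.

* §1 (generic) **`integral_descConj_eq_smul_integral_descConj_of_block`** — the QUOTIENT-target twin of ★ `integral_descConj_eq_smul_integral_of_block`.
* §2 (the LH3 dress on the Cayley chart) `chartOrbG_xRay_eventuallyEq_of_block`, `chartOrbG_xRay_eventuallyEq_descended_of_cutoff`, and the package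
  **`exists_block_testFunction_chartOrbG_xRay_eventuallyEq`** (`∃ f_B ∈ C_c(B)`, `= (a′)_M^β ∘ eM⁻¹(·, r₀)` on the nose, with the displayed identity).
* §3 **`tendsto_absSub_mul_chartOrbG_xRay_of_block`** — the `hray` binder, from §2's eventual identity (for any `f_B`, `K₀`) and ★ (A0-b).
NOT HERE (binders, by name): `eM ∕ Ψβ ∕ hΨβ ∕ hmapβ ∕ hγβ` = (M-UNFOLD) (u2) Cayley side (LH5-p02 (g3) item (6) ∕ F0P3a-p08 (g22)); `hCMx` ∕ `hintx` = (SPLIT-DOCK) (F0P3a-p08 (g22)) for the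
admissible chart `insert w S`; `Λ ≠ 0` is assembled by the consumer from the ★ pieces named above.
HONEST LABEL: HC_CM is proved only modulo the 7 printed citations (2 remaining named inputs: hLiu418 = `stmt-HodgeConjecture-24832`, h413 = `stmt-HodgeConjecture-24833`) until rung 0
closes; count-neutral (measure-theoretic bookkeeping under organ J of `stub_N9`; no stub closes by this file alone).

## References
* [Rogawski1990] J. D. Rogawski, *Automorphic Representations of Unitary Groups in Three Variables*, Ann. of Math. Stud. 123 (1990), §4.12 Lemma 4.12.1 p. 66, §8.2 pp. 114,
  119–124 (the rank-one reduction at a wall; `F_f^A` on the split torus).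
* [Shelstad1979] D. Shelstad, *Characters and inner forms of a quasi-split group over ℝ*, Compositio Math. 39 (1979) 11–45, §4 pp. 22–25, Lemma 4.3 (`Ψ^{T_s}(γ₀^s)` read at the Cayley
  transform).
* [Varadarajan1989] V. S. Varadarajan, *An Introduction to Harmonic Analysis on Semisimple Lie Groups*, Cambridge Stud. Adv. Math. 16 (1989), §6.4 Lemma 21, Thm 23.
* [Folland1995] G. B. Folland, *A Course in Abstract Harmonic Analysis* (1995), §2.6 Thm. 2.49, (2.52).
* [HarishChandra1970] Harish-Chandra (notes by G. van Dijk), *Harmonic Analysis on Reductive p-adic Groups*, LNM 162 (1970), Part I §3 Lemmas 22–23.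
-/

set_option autoImplicit false

noncomputable section

open MeasureTheory MeasureTheory.Measure Set Filter Topology NumberField NumberField.InfinitePlace
open Literature.MeasureTheory.Group Literature.NumberTheory.Automorphic Literature.NumberTheory.Automorphic.UnitaryGroup
open scoped MatrixGroups Matrix Pointwise NNReal Classical

namespace Literature.NumberTheory.Rogawski1990

/-! ## §1 Generic: block reduction of a quotient orbital integral with a QUOTIENT target (non-compact block torus) -/

section Block

variable {G B R : Type*} [Group G] [Group B] [Group R] [TopologicalSpace G] [TopologicalSpace B] [TopologicalSpace R]
  (T : Subgroup G) (A : Subgroup B) (eM : G ≃ₜ* B × R)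
  [MeasurableSpace (G ⧸ T)] [BorelSpace (G ⧸ T)] [MeasurableSpace (B ⧸ A)] [BorelSpace (B ⧸ A)]

/-- **BLOCK REDUCTION OF THE QUOTIENT ORBITAL INTEGRAL, QUOTIENT TARGET** (change of variables along `Ψ : G ⧸ T ≃ₜ B ⧸ A`): for ANY measures `μ` on `G ⧸ T`, `μB` on `B ⧸ A` with
`Ψ_* μ = κ • μB`, `Ψ⁻¹(b A) = eM⁻¹(b, 1) T`, `eM γ = (γ_B, r)` (`γ_B` centralised by `A`) and ANY `F` (a homeomorphism is a measurable equivalence — no continuity needed):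
`∫_{G ⧸ T} F(y γ y⁻¹) dμ(ẏ) = κ • ∫_{B ⧸ A} F(eM⁻¹(b γ_B b⁻¹, r)) dμB(ḃ)` — the twin of ★ `integral_descConj_eq_smul_integral_of_block` when the block torus `A` is NOT compact (split
torus), so one does not un-quotient on the block. [cite: Folland1995, §2.6 Thm. 2.49, (2.52)] [cite: Rogawski1990, §4.12 Lemma 4.12.1 p. 66; §8.2 p. 119] -/
theorem integral_descConj_eq_smul_integral_descConj_of_block (Ψ : G ⧸ T ≃ₜ B ⧸ A) (hΨ : ∀ b : B, Ψ.symm (QuotientGroup.mk b) = QuotientGroup.mk (eM.symm (b, 1)))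
    (μ : Measure (G ⧸ T)) (μB : Measure (B ⧸ A)) {κ : ℝ≥0} (hmap : Measure.map Ψ μ = κ • μB)
    (γ : G) (γB : B) (r : R) (hγ : eM γ = (γB, r)) (hTγ : ∀ t ∈ T, t * γ = γ * t) (hAγ : ∀ a ∈ A, a * γB = γB * a)
    {E : Type*} [NormedAddCommGroup E] [NormedSpace ℝ E] (F : G → E) :
    ∫ q, descConj γ T hTγ F q ∂μ = κ • ∫ y, descConj γB A hAγ (fun b : B => F (eM.symm (b, r))) y ∂μB := by
  -- change of variables along `Ψ`
  have h1 : ∫ q, descConj γ T hTγ F q ∂μ = ∫ q', descConj γ T hTγ F (Ψ.symm q') ∂(Measure.map Ψ μ) := by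
    rw [← Homeomorph.toMeasurableEquiv_coe, integral_map_equiv]
    simp only [Homeomorph.toMeasurableEquiv_coe, Homeomorph.symm_apply_apply]
  rw [h1, hmap, integral_smul_nnreal_measure]
  congr 1
  -- the two integrands agree on `B ⧸ A`
  refine integral_congr_ae (Eventually.of_forall fun y => ?_)
  induction y using QuotientGroup.induction_on with
  | H b =>
    show descConj γ T hTγ F (Ψ.symm (QuotientGroup.mk b)) = descConj γB A hAγ (fun b : B => F (eM.symm (b, r))) (QuotientGroup.mk b)
    rw [descConj_symm_mk_eq_of_block T A eM Ψ hΨ γ γB r hγ hTγ F b, descConj_mk]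

end Block

/-! ## §2 The LH3 dress on the CAYLEY chart `insert w S`: `chartOrbG` along the `x`-ray `hcCayPt w 0 2 p + x • e_{(w,0)}` -/

section Chart

variable (L : Type) [Field L] [NumberField L] [IsCMField L] (α : Fin 3 → L)
  [MeasurableSpace ↥(arch (↥(maximalRealSubfield L)) L (IsCMField.complexConj L) 3 (Matrix.diagonal α))] [BorelSpace ↥(arch (↥(maximalRealSubfield L)) L (IsCMField.complexConj L) 3 (Matrix.diagonal α))]
  (ν' : Measure ↥(arch (↥(maximalRealSubfield L)) L (IsCMField.complexConj L) 3 (Matrix.diagonal α))) [ν'.IsHaarMeasure] [ν'.IsMulRightInvariant]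
  (a' : ↥(arch (↥(maximalRealSubfield L)) L (IsCMField.complexConj L) 3 (Matrix.diagonal α)) → ℂ)
  (S : Finset {w : InfinitePlace L // IsComplex w}) (w : {w : InfinitePlace L // IsComplex w}) (p : {w : InfinitePlace L // IsComplex w} → Fin 3 → ℝ)
  (s : ↥(arch (↥(maximalRealSubfield L)) L (IsCMField.complexConj L) 3 (Matrix.diagonal α)))
  (hT : chartTorusG L α (insert w S) ≤ Subgroup.centralizer ({s} : Set ↥(arch (↥(maximalRealSubfield L)) L (IsCMField.complexConj L) 3 (Matrix.diagonal α))))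
  [MeasurableSpace (↥(Subgroup.centralizer ({s} : Set ↥(arch (↥(maximalRealSubfield L)) L (IsCMField.complexConj L) 3 (Matrix.diagonal α)))) ⧸ (chartTorusG L α (insert w S)).subgroupOf (Subgroup.centralizer ({s} : Set ↥(arch (↥(maximalRealSubfield L)) L (IsCMField.complexConj L) 3 (Matrix.diagonal α)))))]
  [BorelSpace (↥(Subgroup.centralizer ({s} : Set ↥(arch (↥(maximalRealSubfield L)) L (IsCMField.complexConj L) 3 (Matrix.diagonal α)))) ⧸ (chartTorusG L α (insert w S)).subgroupOf (Subgroup.centralizer ({s} : Set ↥(arch (↥(maximalRealSubfield L)) L (IsCMField.complexConj L) 3 (Matrix.diagonal α)))))]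
  -- the block: `U(Φ₂)(ℂ)` in the antidiagonal frame of ★ (A0-b), split torus `torusU`
  {J : Matrix (Fin 2) (Fin 2) ℂ} (hJ : J = (StdForm.antidiagonal 2).over ℂ)
  [MeasurableSpace (↥(unitaryGroupOfForm (starRingEnd ℂ) J) ⧸ torusU (starRingEnd ℂ) J)] [BorelSpace (↥(unitaryGroupOfForm (starRingEnd ℂ) J) ⧸ torusU (starRingEnd ℂ) J)]
  (μ : Measure (↥(unitaryGroupOfForm (starRingEnd ℂ) J) ⧸ torusU (starRingEnd ℂ) J))
  -- the block data ((M-UNFOLD) (u2), Cayley side, discharges these by name)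
  {R : Type*} [Group R] [TopologicalSpace R]
  (eM : ↥(Subgroup.centralizer ({s} : Set ↥(arch (↥(maximalRealSubfield L)) L (IsCMField.complexConj L) 3 (Matrix.diagonal α)))) ≃ₜ* ↥(unitaryGroupOfForm (starRingEnd ℂ) J) × R)
  (Ψβ : (↥(Subgroup.centralizer ({s} : Set ↥(arch (↥(maximalRealSubfield L)) L (IsCMField.complexConj L) 3 (Matrix.diagonal α)))) ⧸ (chartTorusG L α (insert w S)).subgroupOf (Subgroup.centralizer ({s} : Set ↥(arch (↥(maximalRealSubfield L)) L (IsCMField.complexConj L) 3 (Matrix.diagonal α))))) ≃ₜ ↥(unitaryGroupOfForm (starRingEnd ℂ) J) ⧸ torusU (starRingEnd ℂ) J)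
  (hΨβ : ∀ b : ↥(unitaryGroupOfForm (starRingEnd ℂ) J), Ψβ.symm (QuotientGroup.mk b) = QuotientGroup.mk (eM.symm (b, 1)))
  (θ₀ : ℝ) (r₀ : R)
  (hγβ : ∀ x : ℝ, eM ⟨gprimeTorus L α (insert w S) (hcCayPt w 0 2 p + x • (Pi.single w (Pi.single 0 1 : Fin 3 → ℝ) : {w : InfinitePlace L // IsComplex w} → Fin 3 → ℝ)), hT (gprimeTorus_mem_chartTorusG L α (insert w S) _)⟩ =
    ((⟨hypBlockGL x θ₀, hypBlockGL_mem_of_eq_over hJ x θ₀⟩ : ↥(unitaryGroupOfForm (starRingEnd ℂ) J)), r₀))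

include hΨβ hγβ in
/-- **(J-G′-BLOCK-β) FROM AN EVENTUAL DESCENT IDENTITY**: if along the `x`-ray, for small `x > 0`, `chartOrbG L α ν′ (insert w S) a′ (ray x) = C₀ · ∫_{Z(s) ⧸ T′♯} (a′)_M(k · gprimeTorus (ray x) · k⁻¹) dμ♯`
(★ D4b, `C₀ = dt′(B′♯)`), and the block data satisfy `Ψβ⁻¹(b A) = eM⁻¹(b, 1) T′♯`, `Ψβ_* μ♯ = κβ • μ`, `eM(gprimeTorus (ray x)) = (hypBlockGL x θ₀, r₀)`, then for small `x > 0`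
**`chartOrbG L α ν′ (insert w S) a′ (ray x) = (C₀ · κβ) · ∫_{B ⧸ A} (a′)_M(eM⁻¹(y · hypBlockGL x θ₀ · y⁻¹, r₀)) dμ(ẏ)`**. [cite: Rogawski1990, §4.12 Lemma 4.12.1 p. 66; §8.2 pp. 119–124]
[cite: Folland1995, §2.6 (2.52)] [cite: Shelstad1979, Lemma 4.3 (p. 25)] -/
theorem chartOrbG_xRay_eventuallyEq_of_block
    (μZ : Measure (↥(Subgroup.centralizer ({s} : Set ↥(arch (↥(maximalRealSubfield L)) L (IsCMField.complexConj L) 3 (Matrix.diagonal α)))) ⧸ (chartTorusG L α (insert w S)).subgroupOf (Subgroup.centralizer ({s} : Set ↥(arch (↥(maximalRealSubfield L)) L (IsCMField.complexConj L) 3 (Matrix.diagonal α))))))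
    {κβ : ℝ≥0} (hmapβ : Measure.map Ψβ μZ = κβ • μ)
    {aM : ↥(Subgroup.centralizer ({s} : Set ↥(arch (↥(maximalRealSubfield L)) L (IsCMField.complexConj L) 3 (Matrix.diagonal α)))) → ℂ} {C₀ : ℂ}
    (hdescent : ∀ᶠ x in 𝓝[>] (0 : ℝ), chartOrbG L α ν' (insert w S) a' (hcCayPt w 0 2 p + x • (Pi.single w (Pi.single 0 1 : Fin 3 → ℝ) : {w : InfinitePlace L // IsComplex w} → Fin 3 → ℝ)) =
      C₀ * ∫ kq, descConj
          (⟨gprimeTorus L α (insert w S) (hcCayPt w 0 2 p + x • (Pi.single w (Pi.single 0 1 : Fin 3 → ℝ) : {w : InfinitePlace L // IsComplex w} → Fin 3 → ℝ)), hT (gprimeTorus_mem_chartTorusG L α (insert w S) _)⟩ : ↥(Subgroup.centralizer ({s} : Set ↥(arch (↥(maximalRealSubfield L)) L (IsCMField.complexConj L) 3 (Matrix.diagonal α)))))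
          ((chartTorusG L α (insert w S)).subgroupOf (Subgroup.centralizer ({s} : Set ↥(arch (↥(maximalRealSubfield L)) L (IsCMField.complexConj L) 3 (Matrix.diagonal α)))))
          (fun t ht => Subtype.ext (forall_mem_chartTorusG_comm L α (insert w S) (hcCayPt w 0 2 p + x • (Pi.single w (Pi.single 0 1 : Fin 3 → ℝ) : {w : InfinitePlace L // IsComplex w} → Fin 3 → ℝ))
            (t : ↥(arch (↥(maximalRealSubfield L)) L (IsCMField.complexConj L) 3 (Matrix.diagonal α))) (Subgroup.mem_subgroupOf.1 ht)))
          aM kq ∂μZ) :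
    ∀ᶠ x in 𝓝[>] (0 : ℝ), chartOrbG L α ν' (insert w S) a' (hcCayPt w 0 2 p + x • (Pi.single w (Pi.single 0 1 : Fin 3 → ℝ) : {w : InfinitePlace L // IsComplex w} → Fin 3 → ℝ)) =
      (C₀ * ((κβ : ℝ) : ℂ)) * ∫ y, descConj ((⟨hypBlockGL x θ₀, hypBlockGL_mem_of_eq_over hJ x θ₀⟩ : ↥(unitaryGroupOfForm (starRingEnd ℂ) J))) (torusU (starRingEnd ℂ) J)
        (LineRing.forall_mem_torusU_comm (starRingEnd ℂ) J (hypBlockGL_mem_torusU hJ x θ₀)) (fun b : ↥(unitaryGroupOfForm (starRingEnd ℂ) J) => aM (eM.symm (b, r₀))) y ∂μ := by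
  filter_upwards [hdescent] with x hx
  rw [hx, integral_descConj_eq_smul_integral_descConj_of_block _ (torusU (starRingEnd ℂ) J) eM Ψβ hΨβ μZ μ hmapβ _ _ r₀ (hγβ x) _
    (LineRing.forall_mem_torusU_comm (starRingEnd ℂ) J (hypBlockGL_mem_torusU hJ x θ₀)) aM, NNReal.smul_def, Complex.real_smul, mul_assoc]

omit hΨβ hγβ in
/-- **★ D4b ED. 2 ALONG THE `x`-RAY OF THE CAYLEY CHART** (the eventual descent identity): with the SAME cut-off `β ≥ 0` of unit `Z(s)`-mass on `C″ · Z(s)` as on the compact side, if for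
small `x > 0` the conjugates of `gprimeTorus (insert w S) (ray x)` meeting `tsupport a′` lie in `C″ · Z(s)` (`hCMx`, (SPLIT-DOCK)) and the chart integrand at `ray x` is integrable (`hintx`,
regular points), then for small `x > 0`: `chartOrbG L α ν′ (insert w S) a′ (ray x) = dt′(B′♯) · ∫_{Z(s) ⧸ T′♯} (a′)_M^β(k · gprimeTorus (ray x) · k⁻¹) d(νM ∕ νT′♯)`.
[cite: Rogawski1990, §4.12 Lemma 4.12.1 p. 66; §8.2 p. 114] [cite: HarishChandra1970, Part I §3 Lemmas 22–23] [cite: Folland1995, §2.6 Thm. 2.49] -/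
theorem chartOrbG_xRay_eventuallyEq_descended_of_cutoff
    [LocallyCompactSpace ↥(Subgroup.centralizer ({s} : Set ↥(arch (↥(maximalRealSubfield L)) L (IsCMField.complexConj L) 3 (Matrix.diagonal α))))]
    (νM : Measure ↥(Subgroup.centralizer ({s} : Set ↥(arch (↥(maximalRealSubfield L)) L (IsCMField.complexConj L) 3 (Matrix.diagonal α))))) [νM.IsHaarMeasure] [νM.IsMulRightInvariant] [νM.IsInvInvariant] (ha'c : Continuous a')
    {C'' : Set ↥(arch (↥(maximalRealSubfield L)) L (IsCMField.complexConj L) 3 (Matrix.diagonal α))} {β : ↥(arch (↥(maximalRealSubfield L)) L (IsCMField.complexConj L) 3 (Matrix.diagonal α)) → ℝ} (hβc : Continuous β) (hβs : HasCompactSupport β) (hβ0 : ∀ g, 0 ≤ β g)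
    (hβ1 : ∀ x ∈ C'', ∀ k₀ : ↥(Subgroup.centralizer ({s} : Set ↥(arch (↥(maximalRealSubfield L)) L (IsCMField.complexConj L) 3 (Matrix.diagonal α)))), ∫ h : ↥(Subgroup.centralizer ({s} : Set ↥(arch (↥(maximalRealSubfield L)) L (IsCMField.complexConj L) 3 (Matrix.diagonal α)))), β (x * (k₀ : ↥(arch (↥(maximalRealSubfield L)) L (IsCMField.complexConj L) 3 (Matrix.diagonal α))) * (h : ↥(arch (↥(maximalRealSubfield L)) L (IsCMField.complexConj L) 3 (Matrix.diagonal α)))) ∂νM = 1)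
    (hCMx : ∀ᶠ x in 𝓝[>] (0 : ℝ), ∀ y' : ↥(arch (↥(maximalRealSubfield L)) L (IsCMField.complexConj L) 3 (Matrix.diagonal α)), y' * gprimeTorus L α (insert w S) (hcCayPt w 0 2 p + x • (Pi.single w (Pi.single 0 1 : Fin 3 → ℝ) : {w : InfinitePlace L // IsComplex w} → Fin 3 → ℝ)) * y'⁻¹ ∈ tsupport a' → y' ∈ C'' * ((Subgroup.centralizer ({s} : Set ↥(arch (↥(maximalRealSubfield L)) L (IsCMField.complexConj L) 3 (Matrix.diagonal α)))) : Set ↥(arch (↥(maximalRealSubfield L)) L (IsCMField.complexConj L) 3 (Matrix.diagonal α))))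
    (hintx : ∀ᶠ x in 𝓝[>] (0 : ℝ), Integrable (descConj (gprimeTorus L α (insert w S) (hcCayPt w 0 2 p + x • (Pi.single w (Pi.single 0 1 : Fin 3 → ℝ) : {w : InfinitePlace L // IsComplex w} → Fin 3 → ℝ))) (chartTorusG L α (insert w S)) (forall_mem_chartTorusG_comm L α (insert w S) _) a')
      (chartQuotientMeasureG L α ν' (insert w S))) :
    ∀ᶠ x in 𝓝[>] (0 : ℝ), chartOrbG L α ν' (insert w S) a' (hcCayPt w 0 2 p + x • (Pi.single w (Pi.single 0 1 : Fin 3 → ℝ) : {w : InfinitePlace L // IsComplex w} → Fin 3 → ℝ)) =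
      (haveI := isHaarMeasure_chartHaarG L α (insert w S)
       haveI := isInvInvariant_chartHaarG L α (insert w S)
       haveI := isHaarMeasure_map_subgroupOfEquivOfLe_symm hT (chartHaarG L α (insert w S))
       haveI := isInvInvariant_map_subgroupOfEquivOfLe_symm hT (chartHaarG L α (insert w S))
      ((chartHaarG L α (insert w S) (chartBoxImgG L α (insert w S))).toReal : ℂ) *
        ∫ kq, descConj
            (⟨gprimeTorus L α (insert w S) (hcCayPt w 0 2 p + x • (Pi.single w (Pi.single 0 1 : Fin 3 → ℝ) : {w : InfinitePlace L // IsComplex w} → Fin 3 → ℝ)), hT (gprimeTorus_mem_chartTorusG L α (insert w S) _)⟩ : ↥(Subgroup.centralizer ({s} : Set ↥(arch (↥(maximalRealSubfield L)) L (IsCMField.complexConj L) 3 (Matrix.diagonal α)))))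
            ((chartTorusG L α (insert w S)).subgroupOf (Subgroup.centralizer ({s} : Set ↥(arch (↥(maximalRealSubfield L)) L (IsCMField.complexConj L) 3 (Matrix.diagonal α)))))
            (fun t ht => Subtype.ext (forall_mem_chartTorusG_comm L α (insert w S) (hcCayPt w 0 2 p + x • (Pi.single w (Pi.single 0 1 : Fin 3 → ℝ) : {w : InfinitePlace L // IsComplex w} → Fin 3 → ℝ))
              (t : ↥(arch (↥(maximalRealSubfield L)) L (IsCMField.complexConj L) 3 (Matrix.diagonal α))) (Subgroup.mem_subgroupOf.1 ht)))
            (fun m : ↥(Subgroup.centralizer ({s} : Set ↥(arch (↥(maximalRealSubfield L)) L (IsCMField.complexConj L) 3 (Matrix.diagonal α)))) => ∫ x', β x' • a' (x' * (m : ↥(arch (↥(maximalRealSubfield L)) L (IsCMField.complexConj L) 3 (Matrix.diagonal α))) * x'⁻¹) ∂ν') kq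
          ∂(quotientMeasure ((chartTorusG L α (insert w S)).subgroupOf (Subgroup.centralizer ({s} : Set ↥(arch (↥(maximalRealSubfield L)) L (IsCMField.complexConj L) 3 (Matrix.diagonal α)))))
              (Measure.map (Subgroup.subgroupOfEquivOfLe hT).symm (chartHaarG L α (insert w S)))
              (isClosed_subgroupOf_of_isClosed _ _ (isClosed_chartTorusG L α (insert w S))) νM)) := by
  filter_upwards [hCMx, hintx] with x hCM hint
  exact chartOrbG_eq_integral_descended_of_cutoff L α ν' (insert w S) a' ha'c s νM hT hβc hβs hβ0 hβ1 (hcCayPt w 0 2 p + x • (Pi.single w (Pi.single 0 1 : Fin 3 → ℝ) : {w : InfinitePlace L // IsComplex w} → Fin 3 → ℝ)) hint hCM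

include hΨβ hγβ in
/-- **(J-G′-BLOCK-β) — THE PACKAGE.**  Under ★ D4b's data at the wall point `s` (the SAME cut-off `β` and Haar `νM` on `Z(s)` as ★ `exists_block_testFunction_chartOrbG_eventuallyEq` on the
compact side), the eventual binders `hCMx` ∕ `hintx` along the `x`-ray, and the Cayley-side block data `(eM, Ψβ, hΨβ, μ, κβ, hmapβ, θ₀, r₀, hγβ)`: there is ONE test function `f_B ∈ C_c(B)` —
`f_B(b) = (a′)_M^β(eM⁻¹(b, r₀))`, LITERALLY the compact side's when `eM`, `r₀` are the same — with
**`∀ᶠ x in 𝓝[>] 0, chartOrbG L α ν′ (insert w S) a′ (hcCayPt w 0 2 p + x • e_{(w,0)}) = (dt′(B′♯) · κβ) · ∫_{B⧸A} f_B(y · hypBlockGL x θ₀ · y⁻¹) dμ(ẏ)`**.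
[cite: Rogawski1990, §4.12 Lemma 4.12.1 p. 66; §8.2 pp. 119–124] [cite: HarishChandra1970, Part I §3 Lemmas 22–23] [cite: Folland1995, §2.6 Thm. 2.49, (2.52)] [cite: Shelstad1979, Lemma 4.3 (p. 25)] -/
theorem exists_block_testFunction_chartOrbG_xRay_eventuallyEq
    [LocallyCompactSpace ↥(Subgroup.centralizer ({s} : Set ↥(arch (↥(maximalRealSubfield L)) L (IsCMField.complexConj L) 3 (Matrix.diagonal α))))]
    (νM : Measure ↥(Subgroup.centralizer ({s} : Set ↥(arch (↥(maximalRealSubfield L)) L (IsCMField.complexConj L) 3 (Matrix.diagonal α))))) [νM.IsHaarMeasure] [νM.IsMulRightInvariant] [νM.IsInvInvariant] (ha'c : Continuous a') (ha's : HasCompactSupport a')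
    {C'' : Set ↥(arch (↥(maximalRealSubfield L)) L (IsCMField.complexConj L) 3 (Matrix.diagonal α))} {β : ↥(arch (↥(maximalRealSubfield L)) L (IsCMField.complexConj L) 3 (Matrix.diagonal α)) → ℝ} (hβc : Continuous β) (hβs : HasCompactSupport β) (hβ0 : ∀ g, 0 ≤ β g)
    (hβ1 : ∀ x ∈ C'', ∀ k₀ : ↥(Subgroup.centralizer ({s} : Set ↥(arch (↥(maximalRealSubfield L)) L (IsCMField.complexConj L) 3 (Matrix.diagonal α)))), ∫ h : ↥(Subgroup.centralizer ({s} : Set ↥(arch (↥(maximalRealSubfield L)) L (IsCMField.complexConj L) 3 (Matrix.diagonal α)))), β (x * (k₀ : ↥(arch (↥(maximalRealSubfield L)) L (IsCMField.complexConj L) 3 (Matrix.diagonal α))) * (h : ↥(arch (↥(maximalRealSubfield L)) L (IsCMField.complexConj L) 3 (Matrix.diagonal α)))) ∂νM = 1)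
    (hCMx : ∀ᶠ x in 𝓝[>] (0 : ℝ), ∀ y' : ↥(arch (↥(maximalRealSubfield L)) L (IsCMField.complexConj L) 3 (Matrix.diagonal α)), y' * gprimeTorus L α (insert w S) (hcCayPt w 0 2 p + x • (Pi.single w (Pi.single 0 1 : Fin 3 → ℝ) : {w : InfinitePlace L // IsComplex w} → Fin 3 → ℝ)) * y'⁻¹ ∈ tsupport a' → y' ∈ C'' * ((Subgroup.centralizer ({s} : Set ↥(arch (↥(maximalRealSubfield L)) L (IsCMField.complexConj L) 3 (Matrix.diagonal α)))) : Set ↥(arch (↥(maximalRealSubfield L)) L (IsCMField.complexConj L) 3 (Matrix.diagonal α))))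
    (hintx : ∀ᶠ x in 𝓝[>] (0 : ℝ), Integrable (descConj (gprimeTorus L α (insert w S) (hcCayPt w 0 2 p + x • (Pi.single w (Pi.single 0 1 : Fin 3 → ℝ) : {w : InfinitePlace L // IsComplex w} → Fin 3 → ℝ))) (chartTorusG L α (insert w S)) (forall_mem_chartTorusG_comm L α (insert w S) _) a')
      (chartQuotientMeasureG L α ν' (insert w S)))
    {κβ : ℝ≥0}
    (hmapβ : (haveI := isHaarMeasure_chartHaarG L α (insert w S)
       haveI := isInvInvariant_chartHaarG L α (insert w S)
       haveI := isHaarMeasure_map_subgroupOfEquivOfLe_symm hT (chartHaarG L α (insert w S))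
       haveI := isInvInvariant_map_subgroupOfEquivOfLe_symm hT (chartHaarG L α (insert w S))
      Measure.map Ψβ (quotientMeasure ((chartTorusG L α (insert w S)).subgroupOf (Subgroup.centralizer ({s} : Set ↥(arch (↥(maximalRealSubfield L)) L (IsCMField.complexConj L) 3 (Matrix.diagonal α)))))
          (Measure.map (Subgroup.subgroupOfEquivOfLe hT).symm (chartHaarG L α (insert w S)))
          (isClosed_subgroupOf_of_isClosed _ _ (isClosed_chartTorusG L α (insert w S))) νM)) = κβ • μ) :
    ∃ fB : ↥(unitaryGroupOfForm (starRingEnd ℂ) J) → ℂ, Continuous fB ∧ HasCompactSupport fB ∧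
      (fB = fun b => (fun m : ↥(Subgroup.centralizer ({s} : Set ↥(arch (↥(maximalRealSubfield L)) L (IsCMField.complexConj L) 3 (Matrix.diagonal α)))) => ∫ x', β x' • a' (x' * (m : ↥(arch (↥(maximalRealSubfield L)) L (IsCMField.complexConj L) 3 (Matrix.diagonal α))) * x'⁻¹) ∂ν') (eM.symm (b, r₀))) ∧
      ∀ᶠ x in 𝓝[>] (0 : ℝ), chartOrbG L α ν' (insert w S) a' (hcCayPt w 0 2 p + x • (Pi.single w (Pi.single 0 1 : Fin 3 → ℝ) : {w : InfinitePlace L // IsComplex w} → Fin 3 → ℝ)) =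
        ((((haveI := isHaarMeasure_chartHaarG L α (insert w S); chartHaarG L α (insert w S) (chartBoxImgG L α (insert w S)))).toReal : ℂ) * ((κβ : ℝ) : ℂ)) *
          ∫ y, descConj ((⟨hypBlockGL x θ₀, hypBlockGL_mem_of_eq_over hJ x θ₀⟩ : ↥(unitaryGroupOfForm (starRingEnd ℂ) J))) (torusU (starRingEnd ℂ) J)
            (LineRing.forall_mem_torusU_comm (starRingEnd ℂ) J (hypBlockGL_mem_torusU hJ x θ₀)) fB y ∂μ := by
  have hM' : IsClosed ((Subgroup.centralizer ({s} : Set ↥(arch (↥(maximalRealSubfield L)) L (IsCMField.complexConj L) 3 (Matrix.diagonal α)))) : Set ↥(arch (↥(maximalRealSubfield L)) L (IsCMField.complexConj L) 3 (Matrix.diagonal α))) := isClosed_centralizer_singleton_of_t2 _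
  -- the descended function `(a′)_M^β` is in `C_c(Z(s))`
  have haMc : Continuous fun m : ↥(Subgroup.centralizer ({s} : Set ↥(arch (↥(maximalRealSubfield L)) L (IsCMField.complexConj L) 3 (Matrix.diagonal α)))) => ∫ x', β x' • a' (x' * (m : ↥(arch (↥(maximalRealSubfield L)) L (IsCMField.complexConj L) 3 (Matrix.diagonal α))) * x'⁻¹) ∂ν' :=
    continuous_integral_conj_subtype ν' _ hβc hβs ha'c
  have haMs : HasCompactSupport fun m : ↥(Subgroup.centralizer ({s} : Set ↥(arch (↥(maximalRealSubfield L)) L (IsCMField.complexConj L) 3 (Matrix.diagonal α)))) => ∫ x', β x' • a' (x' * (m : ↥(arch (↥(maximalRealSubfield L)) L (IsCMField.complexConj L) 3 (Matrix.diagonal α))) * x'⁻¹) ∂ν' :=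
    hasCompactSupport_integral_conj ν' _ hM' hβs ha's
  haveI : T2Space ↥(unitaryGroupOfForm (starRingEnd ℂ) J) := inferInstance
  refine ⟨_, continuous_comp_symm_prodMk eM haMc r₀, hasCompactSupport_comp_symm_prodMk eM haMs r₀, rfl, ?_⟩
  have hdescent := chartOrbG_xRay_eventuallyEq_descended_of_cutoff L α ν' a' S w p s hT νM ha'c hβc hβs hβ0 hβ1 hCMx hintx
  exact chartOrbG_xRay_eventuallyEq_of_block L α ν' a' S w p s hT hJ μ eM Ψβ hΨβ θ₀ r₀ hγβ _ hmapβ hdescent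

end Chart

/-! ## §3 The (A0) glue: the `x`-ray limit of the NORMALISED split functional — the `hray` binder of the G′-side head -/

section Ray

variable (L : Type) [Field L] [NumberField L] [IsCMField L] (α : Fin 3 → L)
  [MeasurableSpace ↥(arch (↥(maximalRealSubfield L)) L (IsCMField.complexConj L) 3 (Matrix.diagonal α))] [BorelSpace ↥(arch (↥(maximalRealSubfield L)) L (IsCMField.complexConj L) 3 (Matrix.diagonal α))]
  (ν' : Measure ↥(arch (↥(maximalRealSubfield L)) L (IsCMField.complexConj L) 3 (Matrix.diagonal α))) [IsFiniteMeasureOnCompacts ν'] [ν'.IsMulRightInvariant]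
  (a' : ↥(arch (↥(maximalRealSubfield L)) L (IsCMField.complexConj L) 3 (Matrix.diagonal α)) → ℂ)
  (S : Finset {w : InfinitePlace L // IsComplex w}) (w : {w : InfinitePlace L // IsComplex w}) (p : {w : InfinitePlace L // IsComplex w} → Fin 3 → ℝ)
  {J : Matrix (Fin 2) (Fin 2) ℂ} (hJ : J = (StdForm.antidiagonal 2).over ℂ)
  [MeasurableSpace ↥(unitaryGroupOfForm (starRingEnd ℂ) J)] [BorelSpace ↥(unitaryGroupOfForm (starRingEnd ℂ) J)]
  {K : Subgroup ↥(unitaryGroupOfForm (starRingEnd ℂ) J)} (κ : Measure ↥K) (μN : Measure ↥(unipotentU (starRingEnd ℂ) J))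
  [MeasurableSpace (↥(unitaryGroupOfForm (starRingEnd ℂ) J) ⧸ torusU (starRingEnd ℂ) J)] [BorelSpace (↥(unitaryGroupOfForm (starRingEnd ℂ) J) ⧸ torusU (starRingEnd ℂ) J)]
  (μ : Measure (↥(unitaryGroupOfForm (starRingEnd ℂ) J) ⧸ torusU (starRingEnd ℂ) J))

include hJ in
/-- **THE `x`-RAY LIMIT OF THE NORMALISED SPLIT FUNCTIONAL** (LH3-p02 (g3)'s `hray`): if for small `x > 0`
`chartOrbG L α ν′ (insert w S) a′ (ray x) = K₀ · ∫_{B⧸A} f_B(y · hypBlockGL x θ₀ · y⁻¹) dμ` (§2) with `f_B ∈ C_c(B)`, and `μ = C • ((k,n) ↦ k n A)_*(κ ⊗ μ_N)` with `K` compact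
(★ `exists_measure_quotient_torusU_complex_two_eq_smul_map`), then as `x → 0⁺`
**`|eˣ − e⁻ˣ| · chartOrbG L α ν′ (insert w S) a′ (hcCayPt w 0 2 p + x • e_{(w,0)}) ⟶ K₀ · (C • ∫_{K × N} f_B(e^{iθ₀} · k n k⁻¹) d(κ ⊗ μ_N))`** — ★ (A0-b)
`tendsto_abs_sub_smul_integral_descConj_hypBlockGL` at the FIXED `F := f_B` (no moving spectator along the ray), restricted to `𝓝[>] 0`.
[cite: Varadarajan1989, §6.4 Lemma 21, Thm 23] [cite: Shelstad1979, Lemma 4.3 (p. 25)] [cite: Rogawski1990, §8.2 p. 119] -/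
theorem tendsto_absSub_mul_chartOrbG_xRay_of_block (hK : IsCompact (K : Set ↥(unitaryGroupOfForm (starRingEnd ℂ) J))) [IsHaarMeasure κ] [IsHaarMeasure μN] {C : ℝ≥0}
    (hμC : μ = C • Measure.map
      (fun q : ↥K × ↥(unipotentU (starRingEnd ℂ) J) =>
        (QuotientGroup.mk ((q.1 : ↥(unitaryGroupOfForm (starRingEnd ℂ) J)) * (q.2 : ↥(unitaryGroupOfForm (starRingEnd ℂ) J))) : ↥(unitaryGroupOfForm (starRingEnd ℂ) J) ⧸ torusU (starRingEnd ℂ) J))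
      (κ.prod μN))
    {fB : ↥(unitaryGroupOfForm (starRingEnd ℂ) J) → ℂ} (hfBc : Continuous fB) (hfBs : HasCompactSupport fB) (θ₀ : ℝ) {K₀ : ℂ}
    (hblock : ∀ᶠ x in 𝓝[>] (0 : ℝ), chartOrbG L α ν' (insert w S) a' (hcCayPt w 0 2 p + x • (Pi.single w (Pi.single 0 1 : Fin 3 → ℝ) : {w : InfinitePlace L // IsComplex w} → Fin 3 → ℝ)) =
      K₀ * ∫ y, descConj ((⟨hypBlockGL x θ₀, hypBlockGL_mem_of_eq_over hJ x θ₀⟩ : ↥(unitaryGroupOfForm (starRingEnd ℂ) J))) (torusU (starRingEnd ℂ) J)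
        (LineRing.forall_mem_torusU_comm (starRingEnd ℂ) J (hypBlockGL_mem_torusU hJ x θ₀)) fB y ∂μ) :
    Tendsto (fun x : ℝ => ((|Real.exp x - Real.exp (-x)| : ℝ) : ℂ) * chartOrbG L α ν' (insert w S) a' (hcCayPt w 0 2 p + x • (Pi.single w (Pi.single 0 1 : Fin 3 → ℝ) : {w : InfinitePlace L // IsComplex w} → Fin 3 → ℝ))) (𝓝[>] (0 : ℝ))
      (𝓝 (K₀ * ((C : ℝ) • ∫ q : ↥K × ↥(unipotentU (starRingEnd ℂ) J),
        fB (((⟨hypBlockGL 0 θ₀, hypBlockGL_mem_of_eq_over hJ 0 θ₀⟩ : ↥(unitaryGroupOfForm (starRingEnd ℂ) J))) *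
          ((q.1 : ↥(unitaryGroupOfForm (starRingEnd ℂ) J)) * (q.2 : ↥(unitaryGroupOfForm (starRingEnd ℂ) J)) * (q.1 : ↥(unitaryGroupOfForm (starRingEnd ℂ) J))⁻¹)) ∂(κ.prod μN)))) := by
  -- ★ (A0-b) at the fixed block function, restricted to `𝓝[>] 0`
  have hA0 := (tendsto_abs_sub_smul_integral_descConj_hypBlockGL hJ κ μN μ hK hμC fB hfBc hfBs θ₀).mono_left
    (nhdsWithin_mono (0 : ℝ) (fun x (hx : 0 < x) => ne_of_gt hx))
  have hlim := hA0.const_mul K₀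
  refine hlim.congr' ?_
  filter_upwards [hblock] with x hx
  rw [hx, Complex.real_smul, ← mul_assoc, ← mul_assoc, mul_comm K₀]

end Ray

end Literature.NumberTheory.Rogawski1990

end

/-! ## §4 (EDITION 2, append-only) `hΛ`: the `x`-ray limit VALUE is NON-ZERO for a non-negative test function positive at the wall point -/

noncomputable section

namespace Literature.NumberTheory.Rogawski1990

-- inside `namespace Literature.…` the directory namespaces `Literature.MeasureTheory` ∕ `Literature.Topology` shadow Mathlib's (CONVENTIONS §2)
open _root_.MeasureTheory _root_.MeasureTheory.Measure Set Filter _root_.Topology NumberField NumberField.InfinitePlace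
open Literature.MeasureTheory.Group Literature.NumberTheory.Automorphic Literature.NumberTheory.Automorphic.UnitaryGroup
open scoped MatrixGroups Matrix Pointwise NNReal Classical

section Nondeg

variable (L : Type) [Field L] [NumberField L] [IsCMField L] (α : Fin 3 → L)
  [MeasurableSpace ↥(arch (↥(maximalRealSubfield L)) L (IsCMField.complexConj L) 3 (Matrix.diagonal α))] [BorelSpace ↥(arch (↥(maximalRealSubfield L)) L (IsCMField.complexConj L) 3 (Matrix.diagonal α))]
  (ν' : Measure ↥(arch (↥(maximalRealSubfield L)) L (IsCMField.complexConj L) 3 (Matrix.diagonal α))) [ν'.IsHaarMeasure]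
  (a' : ↥(arch (↥(maximalRealSubfield L)) L (IsCMField.complexConj L) 3 (Matrix.diagonal α)) → ℂ) (s : ↥(arch (↥(maximalRealSubfield L)) L (IsCMField.complexConj L) 3 (Matrix.diagonal α)))
  {J : Matrix (Fin 2) (Fin 2) ℂ} (hJ : J = (StdForm.antidiagonal 2).over ℂ)
  [MeasurableSpace ↥(unitaryGroupOfForm (starRingEnd ℂ) J)] [BorelSpace ↥(unitaryGroupOfForm (starRingEnd ℂ) J)]
  {K : Subgroup ↥(unitaryGroupOfForm (starRingEnd ℂ) J)} (hK : IsCompact (K : Set ↥(unitaryGroupOfForm (starRingEnd ℂ) J))) (κ : Measure ↥K) (μN : Measure ↥(unipotentU (starRingEnd ℂ) J)) [IsHaarMeasure κ] [IsHaarMeasure μN]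
  {R : Type*} [Group R] [TopologicalSpace R] [T1Space R]
  (eM : ↥(Subgroup.centralizer ({s} : Set ↥(arch (↥(maximalRealSubfield L)) L (IsCMField.complexConj L) 3 (Matrix.diagonal α)))) ≃ₜ* ↥(unitaryGroupOfForm (starRingEnd ℂ) J) × R) (θ₀ : ℝ) (r₀ : R)

include hJ hK in
/-- **`hΛ` — THE `x`-RAY LIMIT VALUE OF THE NORMALISED SPLIT FUNCTIONAL IS NON-ZERO** for the block test function `f_B = (a′)_M^β ∘ eM⁻¹(·, r₀)` of a REAL NON-NEGATIVE test function `a′`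
POSITIVE AT THE WALL POINT `s` (★ (N1′) `exists_archSmooth_nonneg_ne_zero_at` at `γ₀ := s`): `K₀ · (C • ∫_{K×N} f_B(e^{iθ₀} · k n k⁻¹) d(κ ⊗ μ_N)) ≠ 0` whenever `K₀ ≠ 0` (box mass ×
Haar ratio), `C ≠ 0` (★ `exists_measure_quotient_torusU_complex_two_eq_smul_map`), the cut-off `β ≥ 0` is positive somewhere on `Z(s)` (unit mass on a coset meeting `Z(s)`; ★
`exists_descended_forall_orbitalIntegral_eq_nonneg` ∕ ★ `exists_continuous_hasCompactSupport_integral_comp_mul_eq_one_pos`), and the block vertex `eM⁻¹(hypBlockGL 0 θ₀, r₀)` IS `s`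
(`hvert`, (M-UNFOLD)'s `hγβ` at `x = 0`).  Proof: `f_B = ψ ∘ ι` with `ψ = (a′)_M^β` continuous, compactly supported, real `≥ 0` (★ `re_integral_conj_nonneg` ∕ `im_integral_conj_eq_zero`)
and positive at `s` (★ `re_integral_conj_pos_of_comm`: `s` is central in `Z(s)`), `ι = eM⁻¹(·, r₀)` a closed embedding — then ★ `smul_integral_prod_conj_hypBlockGL_comp_ne_zero_of_re_nonneg`.
[cite: Shelstad1979, Lemma 4.3 (p. 25); Prop. 4.5 (p. 26)] [cite: Varadarajan1989, §6.4 Thm 23] [cite: Rogawski1990, §4.12 Lemma 4.12.1 p. 66; §8.2 p. 122] -/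
theorem mul_smul_integral_prod_conj_blockTestFunction_ne_zero
    (hvert : ((eM.symm ((⟨hypBlockGL 0 θ₀, hypBlockGL_mem_of_eq_over hJ 0 θ₀⟩ : ↥(unitaryGroupOfForm (starRingEnd ℂ) J)), r₀) : ↥(Subgroup.centralizer ({s} : Set ↥(arch (↥(maximalRealSubfield L)) L (IsCMField.complexConj L) 3 (Matrix.diagonal α))))) : ↥(arch (↥(maximalRealSubfield L)) L (IsCMField.complexConj L) 3 (Matrix.diagonal α))) = s)
    {β : ↥(arch (↥(maximalRealSubfield L)) L (IsCMField.complexConj L) 3 (Matrix.diagonal α)) → ℝ} (hβc : Continuous β) (hβs : HasCompactSupport β) (hβ0 : ∀ g, 0 ≤ β g) (hβpos : ∃ h₀ : ↥(Subgroup.centralizer ({s} : Set ↥(arch (↥(maximalRealSubfield L)) L (IsCMField.complexConj L) 3 (Matrix.diagonal α)))), 0 < β (h₀ : ↥(arch (↥(maximalRealSubfield L)) L (IsCMField.complexConj L) 3 (Matrix.diagonal α))))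
    (ha'c : Continuous a') (ha's : HasCompactSupport a') (ha'0 : ∀ g, 0 ≤ (a' g).re ∧ (a' g).im = 0) (ha'pos : 0 < (a' s).re)
    {fB : ↥(unitaryGroupOfForm (starRingEnd ℂ) J) → ℂ} (hfB : fB = (fun b => (fun m : ↥(Subgroup.centralizer ({s} : Set ↥(arch (↥(maximalRealSubfield L)) L (IsCMField.complexConj L) 3 (Matrix.diagonal α)))) => ∫ x', β x' • a' (x' * (m : ↥(arch (↥(maximalRealSubfield L)) L (IsCMField.complexConj L) 3 (Matrix.diagonal α))) * x'⁻¹) ∂ν') (eM.symm (b, r₀))))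
    {C : NNReal} (hC : C ≠ 0) {K₀ : ℂ} (hK₀ : K₀ ≠ 0) :
    K₀ * ((C : ℝ) • ∫ q : ↥K × ↥(unipotentU (starRingEnd ℂ) J),
        fB (((⟨hypBlockGL 0 θ₀, hypBlockGL_mem_of_eq_over hJ 0 θ₀⟩ : ↥(unitaryGroupOfForm (starRingEnd ℂ) J))) *
          ((q.1 : ↥(unitaryGroupOfForm (starRingEnd ℂ) J)) * (q.2 : ↥(unitaryGroupOfForm (starRingEnd ℂ) J)) * (q.1 : ↥(unitaryGroupOfForm (starRingEnd ℂ) J))⁻¹)) ∂(κ.prod μN)) ≠ 0 := by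
  have hM' : IsClosed ((Subgroup.centralizer ({s} : Set ↥(arch (↥(maximalRealSubfield L)) L (IsCMField.complexConj L) 3 (Matrix.diagonal α)))) : Set ↥(arch (↥(maximalRealSubfield L)) L (IsCMField.complexConj L) 3 (Matrix.diagonal α))) := isClosed_centralizer_singleton_of_t2 _
  -- `ψ = (a′)_M^β` on `Z(s)`: continuous, compactly supported, real non-negative, positive at `s`
  have hψ : Continuous fun m : ↥(Subgroup.centralizer ({s} : Set ↥(arch (↥(maximalRealSubfield L)) L (IsCMField.complexConj L) 3 (Matrix.diagonal α)))) => ∫ x', β x' • a' (x' * (m : ↥(arch (↥(maximalRealSubfield L)) L (IsCMField.complexConj L) 3 (Matrix.diagonal α))) * x'⁻¹) ∂ν' :=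
    continuous_integral_conj_subtype ν' _ hβc hβs ha'c
  have hψc : HasCompactSupport fun m : ↥(Subgroup.centralizer ({s} : Set ↥(arch (↥(maximalRealSubfield L)) L (IsCMField.complexConj L) 3 (Matrix.diagonal α)))) => ∫ x', β x' • a' (x' * (m : ↥(arch (↥(maximalRealSubfield L)) L (IsCMField.complexConj L) 3 (Matrix.diagonal α))) * x'⁻¹) ∂ν' :=
    hasCompactSupport_integral_conj ν' _ hM' hβs ha's
  have hψ0 : ∀ m : ↥(Subgroup.centralizer ({s} : Set ↥(arch (↥(maximalRealSubfield L)) L (IsCMField.complexConj L) 3 (Matrix.diagonal α)))), 0 ≤ (∫ x', β x' • a' (x' * (m : ↥(arch (↥(maximalRealSubfield L)) L (IsCMField.complexConj L) 3 (Matrix.diagonal α))) * x'⁻¹) ∂ν').re ∧ (∫ x', β x' • a' (x' * (m : ↥(arch (↥(maximalRealSubfield L)) L (IsCMField.complexConj L) 3 (Matrix.diagonal α))) * x'⁻¹) ∂ν').im = 0 :=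
    fun m => ⟨re_integral_conj_nonneg ν' hβ0 ha'0 (m : ↥(arch (↥(maximalRealSubfield L)) L (IsCMField.complexConj L) 3 (Matrix.diagonal α))), im_integral_conj_eq_zero ν' β ha'0 (m : ↥(arch (↥(maximalRealSubfield L)) L (IsCMField.complexConj L) 3 (Matrix.diagonal α)))⟩
  -- the block inclusion `ι = eM⁻¹(·, r₀)` is a closed embedding
  have hrange : Set.range (fun u : ↥(unitaryGroupOfForm (starRingEnd ℂ) J) => (u, r₀)) = (Set.univ : Set ↥(unitaryGroupOfForm (starRingEnd ℂ) J)) ×ˢ ({r₀} : Set R) := by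
    ext ⟨u, r⟩
    simp only [Set.mem_range, Prod.mk.injEq, Set.mem_prod, Set.mem_univ, Set.mem_singleton_iff, true_and]
    constructor
    · rintro ⟨u', hu', hr⟩
      exact hr.symm
    · intro hr
      exact ⟨u, rfl, hr.symm⟩
  have hι₀ : IsClosedEmbedding (fun u : ↥(unitaryGroupOfForm (starRingEnd ℂ) J) => (u, r₀)) :=
    ⟨isEmbedding_prodMkLeft r₀, by rw [hrange]; exact isClosed_univ.prod isClosed_singleton⟩
  have hι : IsClosedEmbedding (fun u : ↥(unitaryGroupOfForm (starRingEnd ℂ) J) => eM.symm (u, r₀)) := eM.symm.toHomeomorph.isClosedEmbedding.comp hι₀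
  -- positivity at the vertex: `eM⁻¹(z·1, r₀) = s` is central in `Z(s)`
  obtain ⟨h₀, hh₀⟩ := hβpos
  have hcomm : (h₀ : ↥(arch (↥(maximalRealSubfield L)) L (IsCMField.complexConj L) 3 (Matrix.diagonal α))) * s = s * (h₀ : ↥(arch (↥(maximalRealSubfield L)) L (IsCMField.complexConj L) 3 (Matrix.diagonal α))) := Subgroup.mem_centralizer_singleton_iff.1 h₀.2
  have hpos : 0 < (∫ x', β x' • a' (x' * ((eM.symm ((⟨hypBlockGL 0 θ₀, hypBlockGL_mem_of_eq_over hJ 0 θ₀⟩ : ↥(unitaryGroupOfForm (starRingEnd ℂ) J)), r₀) : ↥(Subgroup.centralizer ({s} : Set ↥(arch (↥(maximalRealSubfield L)) L (IsCMField.complexConj L) 3 (Matrix.diagonal α))))) : ↥(arch (↥(maximalRealSubfield L)) L (IsCMField.complexConj L) 3 (Matrix.diagonal α))) * x'⁻¹) ∂ν').re := by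
    rw [hvert]
    exact re_integral_conj_pos_of_comm ν' hβc hβs hβ0 ha'c ha'0 hcomm hh₀ ha'pos
  subst hfB
  exact mul_ne_zero hK₀ (smul_integral_prod_conj_hypBlockGL_comp_ne_zero_of_re_nonneg hJ hK κ μN hC hψ hψc hψ0 hι θ₀ hpos)

end Nondeg

end Literature.NumberTheory.Rogawski1990

end

/-! ## §5 (EDITION 3, append-only) THE SHARED CURRENCY: the `x`-ray limit `hray` and its non-vanishing `hΛ` read against the SHARED rank-one datum
`(μ₀′, C₂, SharedA0)` of skeleton v3.4∕v3.6's `JumpGSideStatement` (LH3-p02 (g3) 2026-09-02T08:21:05Z «≠ currency, ONE token change» ∕ 08:56:59Z sliver (b4) → F0P3b-p01 (g15)) -/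

noncomputable section

namespace Literature.NumberTheory.Rogawski1990

-- inside `namespace Literature.…` the directory namespaces `Literature.MeasureTheory` ∕ `Literature.Topology` shadow Mathlib's (CONVENTIONS §2)
open _root_.MeasureTheory _root_.MeasureTheory.Measure Set Filter _root_.Topology NumberField NumberField.InfinitePlace
open Literature.MeasureTheory.Group Literature.NumberTheory.Automorphic Literature.NumberTheory.Automorphic.UnitaryGroup
open scoped MatrixGroups Matrix Pointwise NNReal Classical Real

section SharedRay

variable (L : Type) [Field L] [NumberField L] [IsCMField L] (α : Fin 3 → L)
  [MeasurableSpace ↥(arch (↥(maximalRealSubfield L)) L (IsCMField.complexConj L) 3 (Matrix.diagonal α))] [BorelSpace ↥(arch (↥(maximalRealSubfield L)) L (IsCMField.complexConj L) 3 (Matrix.diagonal α))]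
  (ν' : Measure ↥(arch (↥(maximalRealSubfield L)) L (IsCMField.complexConj L) 3 (Matrix.diagonal α))) [IsFiniteMeasureOnCompacts ν'] [ν'.IsMulRightInvariant]
  (a' : ↥(arch (↥(maximalRealSubfield L)) L (IsCMField.complexConj L) 3 (Matrix.diagonal α)) → ℂ)
  (S : Finset {w : InfinitePlace L // IsComplex w}) (w : {w : InfinitePlace L // IsComplex w}) (p : {w : InfinitePlace L // IsComplex w} → Fin 3 → ℝ)
  {J : Matrix (Fin 2) (Fin 2) ℂ} (hJ : J = (StdForm.antidiagonal 2).over ℂ)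
  [MeasurableSpace (↥(unitaryGroupOfForm (starRingEnd ℂ) J) ⧸ torusU (starRingEnd ℂ) J)]
  (μ₀' : Measure (↥(unitaryGroupOfForm (starRingEnd ℂ) J) ⧸ torusU (starRingEnd ℂ) J))

/-- **`hray` IN THE SHARED CURRENCY.**  If for small `x > 0` `chartOrbG L α ν′ (insert w S) a′ (ray x) = K₀ · ∫_{B⧸A} f_B(y · hypBlockGL x θ₀ · y⁻¹) dμ₀′` (§2, with the SHARED
`μ₀′` as the block quotient measure), `f` is a continuous compactly supported ambient extension of `f_B` (`hfF`, Tietze), and `hA0` is the SHARED (A0) text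
«`|eˣ − e⁻ˣ| • ∫ descConj (hypBlockGL x θ) (f ∘ coe) dμ₀′ ⟶ C₂ • (cone⁺ + cone⁻)(f, θ)` along `𝓝[≠] 0`» (skeleton v3.6 `JumpGSideStatement`, binder `hA0`, VERBATIM up to bound names), then
**`|eˣ − e⁻ˣ| · chartOrbG L α ν′ (insert w S) a′ (hcCayPt w 0 2 p + x • e_{(w,0)}) ⟶ K₀ · (C₂ · (cone⁺ + cone⁻)(f, θ₀))`** as `x → 0⁺` — `hA0 f hf hfc θ₀`, `hfF` under the integral,
`Complex.real_smul`, `𝓝[≠] ↦ 𝓝[>]` by `mono_left`. [cite: Varadarajan1989, §6.4 Thm 23] [cite: Shelstad1979, Lemma 4.3 (p. 25)] [cite: Rogawski1990, §8.2 p. 119] -/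
theorem tendsto_absSub_mul_chartOrbG_xRay_of_block_shared {C₂ : ℝ}
    (hA0 : (∀ (f : Matrix (Fin 2) (Fin 2) ℂ → ℂ), Continuous f → HasCompactSupport f → ∀ θ : ℝ,
      Tendsto (fun x : ℝ => |Real.exp x - Real.exp (-x)| •
          ∫ y, descConj (⟨hypBlockGL x θ, hypBlockGL_mem_of_eq_over hJ x θ⟩ : ↥(unitaryGroupOfForm (starRingEnd ℂ) J)) (torusU (starRingEnd ℂ) J)
            (LineRing.forall_mem_torusU_comm (starRingEnd ℂ) J (hypBlockGL_mem_torusU hJ x θ))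
            (fun g : ↥(unitaryGroupOfForm (starRingEnd ℂ) J) => f ((g : GL (Fin 2) ℂ) : Matrix (Fin 2) (Fin 2) ℂ)) y ∂μ₀')
        (𝓝[≠] 0)
        (𝓝 (C₂ • ((∫ q in Ioi (0 : ℝ) ×ˢ Ioc (0 : ℝ) (2 * π),
              f ((!![(1 : ℂ), 1; 1, -1] : Matrix (Fin 2) (Fin 2) ℂ) *
                (Complex.exp ((θ : ℂ) * Complex.I) • (1 : Matrix (Fin 2) (Fin 2) ℂ) +
                  q.1 • Matrix.diagonal ![Complex.exp ((θ : ℂ) * Complex.I) * Complex.I, -(Complex.exp ((θ : ℂ) * Complex.I) * Complex.I)] +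
                  q.1 • !![(0 : ℂ), -(Complex.exp ((θ : ℂ) * Complex.I) * Complex.I) * Complex.exp (-((q.2 : ℂ) * Complex.I));
                    (Complex.exp ((θ : ℂ) * Complex.I) * Complex.I) * Complex.exp ((q.2 : ℂ) * Complex.I), 0]) *
                !![(1 / 2 : ℂ), 1 / 2; 1 / 2, -(1 / 2)])) +
            ∫ q in Ioi (0 : ℝ) ×ˢ Ioc (0 : ℝ) (2 * π),
              f ((!![(1 : ℂ), 1; 1, -1] : Matrix (Fin 2) (Fin 2) ℂ) *
                (Complex.exp ((θ : ℂ) * Complex.I) • (1 : Matrix (Fin 2) (Fin 2) ℂ) +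
                  q.1 • Matrix.diagonal ![-(Complex.exp ((θ : ℂ) * Complex.I) * Complex.I), Complex.exp ((θ : ℂ) * Complex.I) * Complex.I] +
                  q.1 • !![(0 : ℂ), (Complex.exp ((θ : ℂ) * Complex.I) * Complex.I) * Complex.exp (-((q.2 : ℂ) * Complex.I));
                    -(Complex.exp ((θ : ℂ) * Complex.I) * Complex.I) * Complex.exp ((q.2 : ℂ) * Complex.I), 0]) *
                !![(1 / 2 : ℂ), 1 / 2; 1 / 2, -(1 / 2)]))))))
    {fB : ↥(unitaryGroupOfForm (starRingEnd ℂ) J) → ℂ} (f : Matrix (Fin 2) (Fin 2) ℂ → ℂ) (hf : Continuous f) (hfc : HasCompactSupport f)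
    (hfF : ∀ g : ↥(unitaryGroupOfForm (starRingEnd ℂ) J), f ((g : GL (Fin 2) ℂ) : Matrix (Fin 2) (Fin 2) ℂ) = fB g) (θ₀ : ℝ) {K₀ : ℂ}
    (hblock : ∀ᶠ x in 𝓝[>] (0 : ℝ), chartOrbG L α ν' (insert w S) a' (hcCayPt w 0 2 p + x • (Pi.single w (Pi.single 0 1 : Fin 3 → ℝ) : {w : InfinitePlace L // IsComplex w} → Fin 3 → ℝ)) =
      K₀ * ∫ y, descConj ((⟨hypBlockGL x θ₀, hypBlockGL_mem_of_eq_over hJ x θ₀⟩ : ↥(unitaryGroupOfForm (starRingEnd ℂ) J))) (torusU (starRingEnd ℂ) J)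
        (LineRing.forall_mem_torusU_comm (starRingEnd ℂ) J (hypBlockGL_mem_torusU hJ x θ₀)) fB y ∂μ₀') :
    Tendsto (fun x : ℝ => ((|Real.exp x - Real.exp (-x)| : ℝ) : ℂ) * chartOrbG L α ν' (insert w S) a' (hcCayPt w 0 2 p + x • (Pi.single w (Pi.single 0 1 : Fin 3 → ℝ) : {w : InfinitePlace L // IsComplex w} → Fin 3 → ℝ))) (𝓝[>] (0 : ℝ))
      (𝓝 (K₀ * ((C₂ : ℂ) * ((∫ q in Ioi (0 : ℝ) ×ˢ Ioc (0 : ℝ) (2 * π),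
              f ((!![(1 : ℂ), 1; 1, -1] : Matrix (Fin 2) (Fin 2) ℂ) *
                (Complex.exp ((θ₀ : ℂ) * Complex.I) • (1 : Matrix (Fin 2) (Fin 2) ℂ) +
                  q.1 • Matrix.diagonal ![Complex.exp ((θ₀ : ℂ) * Complex.I) * Complex.I, -(Complex.exp ((θ₀ : ℂ) * Complex.I) * Complex.I)] +
                  q.1 • !![(0 : ℂ), -(Complex.exp ((θ₀ : ℂ) * Complex.I) * Complex.I) * Complex.exp (-((q.2 : ℂ) * Complex.I));
                    (Complex.exp ((θ₀ : ℂ) * Complex.I) * Complex.I) * Complex.exp ((q.2 : ℂ) * Complex.I), 0]) *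
                !![(1 / 2 : ℂ), 1 / 2; 1 / 2, -(1 / 2)])) +
            ∫ q in Ioi (0 : ℝ) ×ˢ Ioc (0 : ℝ) (2 * π),
              f ((!![(1 : ℂ), 1; 1, -1] : Matrix (Fin 2) (Fin 2) ℂ) *
                (Complex.exp ((θ₀ : ℂ) * Complex.I) • (1 : Matrix (Fin 2) (Fin 2) ℂ) +
                  q.1 • Matrix.diagonal ![-(Complex.exp ((θ₀ : ℂ) * Complex.I) * Complex.I), Complex.exp ((θ₀ : ℂ) * Complex.I) * Complex.I] +
                  q.1 • !![(0 : ℂ), (Complex.exp ((θ₀ : ℂ) * Complex.I) * Complex.I) * Complex.exp (-((q.2 : ℂ) * Complex.I));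
                    -(Complex.exp ((θ₀ : ℂ) * Complex.I) * Complex.I) * Complex.exp ((q.2 : ℂ) * Complex.I), 0]) *
                !![(1 / 2 : ℂ), 1 / 2; 1 / 2, -(1 / 2)]))))) := by
  have hA := hA0 f hf hfc θ₀
  have hfun : (fun g : ↥(unitaryGroupOfForm (starRingEnd ℂ) J) => f ((g : GL (Fin 2) ℂ) : Matrix (Fin 2) (Fin 2) ℂ)) = fB := funext hfF
  rw [hfun] at hA
  have h1 := (hA.mono_left (nhdsWithin_mono (0 : ℝ) (fun x (hx : 0 < x) => ne_of_gt hx))).const_mul K₀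
  simp only [Complex.real_smul] at h1
  refine h1.congr' ?_
  filter_upwards [hblock] with x hx
  rw [hx]
  ring

end SharedRay

section SharedChart

variable (L : Type) [Field L] [NumberField L] [IsCMField L] (α : Fin 3 → L)
  [MeasurableSpace ↥(arch (↥(maximalRealSubfield L)) L (IsCMField.complexConj L) 3 (Matrix.diagonal α))] [BorelSpace ↥(arch (↥(maximalRealSubfield L)) L (IsCMField.complexConj L) 3 (Matrix.diagonal α))]
  (ν' : Measure ↥(arch (↥(maximalRealSubfield L)) L (IsCMField.complexConj L) 3 (Matrix.diagonal α))) [ν'.IsHaarMeasure] [ν'.IsMulRightInvariant]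
  (a' : ↥(arch (↥(maximalRealSubfield L)) L (IsCMField.complexConj L) 3 (Matrix.diagonal α)) → ℂ)
  (S : Finset {w : InfinitePlace L // IsComplex w}) (w : {w : InfinitePlace L // IsComplex w}) (p : {w : InfinitePlace L // IsComplex w} → Fin 3 → ℝ)
  (s : ↥(arch (↥(maximalRealSubfield L)) L (IsCMField.complexConj L) 3 (Matrix.diagonal α)))
  (hT : chartTorusG L α (insert w S) ≤ Subgroup.centralizer ({s} : Set ↥(arch (↥(maximalRealSubfield L)) L (IsCMField.complexConj L) 3 (Matrix.diagonal α))))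
  [MeasurableSpace (↥(Subgroup.centralizer ({s} : Set ↥(arch (↥(maximalRealSubfield L)) L (IsCMField.complexConj L) 3 (Matrix.diagonal α)))) ⧸ (chartTorusG L α (insert w S)).subgroupOf (Subgroup.centralizer ({s} : Set ↥(arch (↥(maximalRealSubfield L)) L (IsCMField.complexConj L) 3 (Matrix.diagonal α)))))]
  [BorelSpace (↥(Subgroup.centralizer ({s} : Set ↥(arch (↥(maximalRealSubfield L)) L (IsCMField.complexConj L) 3 (Matrix.diagonal α)))) ⧸ (chartTorusG L α (insert w S)).subgroupOf (Subgroup.centralizer ({s} : Set ↥(arch (↥(maximalRealSubfield L)) L (IsCMField.complexConj L) 3 (Matrix.diagonal α)))))]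
  -- the block: `U(Φ₂)(ℂ)` in the antidiagonal frame of ★ (A0-b), split torus `torusU`
  {J : Matrix (Fin 2) (Fin 2) ℂ} (hJ : J = (StdForm.antidiagonal 2).over ℂ)
  [MeasurableSpace (↥(unitaryGroupOfForm (starRingEnd ℂ) J) ⧸ torusU (starRingEnd ℂ) J)] [BorelSpace (↥(unitaryGroupOfForm (starRingEnd ℂ) J) ⧸ torusU (starRingEnd ℂ) J)]
  (μ₀' : Measure (↥(unitaryGroupOfForm (starRingEnd ℂ) J) ⧸ torusU (starRingEnd ℂ) J))
  -- the block data ((M-UNFOLD) (u2), Cayley side, discharges these by name)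
  {R : Type*} [Group R] [TopologicalSpace R]
  (eM : ↥(Subgroup.centralizer ({s} : Set ↥(arch (↥(maximalRealSubfield L)) L (IsCMField.complexConj L) 3 (Matrix.diagonal α)))) ≃ₜ* ↥(unitaryGroupOfForm (starRingEnd ℂ) J) × R)
  (Ψβ : (↥(Subgroup.centralizer ({s} : Set ↥(arch (↥(maximalRealSubfield L)) L (IsCMField.complexConj L) 3 (Matrix.diagonal α)))) ⧸ (chartTorusG L α (insert w S)).subgroupOf (Subgroup.centralizer ({s} : Set ↥(arch (↥(maximalRealSubfield L)) L (IsCMField.complexConj L) 3 (Matrix.diagonal α))))) ≃ₜ ↥(unitaryGroupOfForm (starRingEnd ℂ) J) ⧸ torusU (starRingEnd ℂ) J)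
  (hΨβ : ∀ b : ↥(unitaryGroupOfForm (starRingEnd ℂ) J), Ψβ.symm (QuotientGroup.mk b) = QuotientGroup.mk (eM.symm (b, 1)))
  (θ₀ : ℝ) (r₀ : R)
  (hγβ : ∀ x : ℝ, eM ⟨gprimeTorus L α (insert w S) (hcCayPt w 0 2 p + x • (Pi.single w (Pi.single 0 1 : Fin 3 → ℝ) : {w : InfinitePlace L // IsComplex w} → Fin 3 → ℝ)), hT (gprimeTorus_mem_chartTorusG L α (insert w S) _)⟩ =
    ((⟨hypBlockGL x θ₀, hypBlockGL_mem_of_eq_over hJ x θ₀⟩ : ↥(unitaryGroupOfForm (starRingEnd ℂ) J)), r₀))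


include hΨβ hγβ in
/-- **`hray` IN THE SHARED CURRENCY, WITH ★ D4b's DESCENT AND THE BLOCK PACKAGE INSTANTIATED** (LH3-p02 (g3)'s requested binder list): under the §2 binders with the SHARED `μ₀′`
as the block quotient measure (`hmapβ : Ψβ_* μ♯ = κβ • μ₀′`), the SHARED (A0) text `hA0`, and an ambient extension `f` of the block test function `(a′)_M^β ∘ eM⁻¹(·, r₀)` (`hfF`),
**`|eˣ − e⁻ˣ| · chartOrbG L α ν′ (insert w S) a′ (ray x) ⟶ (dt′(B′♯) · κβ) · (C₂ · (cone⁺ + cone⁻)(f, θ₀))`** as `x → 0⁺` (§2 `exists_block_testFunction_chartOrbG_xRay_eventuallyEq` ∘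
`tendsto_absSub_mul_chartOrbG_xRay_of_block_shared`). [cite: Rogawski1990, §4.12 Lemma 4.12.1 p. 66; §8.2 pp. 119–124] [cite: Shelstad1979, Lemma 4.3 (p. 25)] [cite: Varadarajan1989, §6.4 Thm 23] -/
theorem tendsto_absSub_mul_chartOrbG_xRay_descended_of_cutoff_shared
    [LocallyCompactSpace ↥(Subgroup.centralizer ({s} : Set ↥(arch (↥(maximalRealSubfield L)) L (IsCMField.complexConj L) 3 (Matrix.diagonal α))))]
    (νM : Measure ↥(Subgroup.centralizer ({s} : Set ↥(arch (↥(maximalRealSubfield L)) L (IsCMField.complexConj L) 3 (Matrix.diagonal α))))) [νM.IsHaarMeasure] [νM.IsMulRightInvariant] [νM.IsInvInvariant] (ha'c : Continuous a') (ha's : HasCompactSupport a')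
    {C'' : Set ↥(arch (↥(maximalRealSubfield L)) L (IsCMField.complexConj L) 3 (Matrix.diagonal α))} {β : ↥(arch (↥(maximalRealSubfield L)) L (IsCMField.complexConj L) 3 (Matrix.diagonal α)) → ℝ} (hβc : Continuous β) (hβs : HasCompactSupport β) (hβ0 : ∀ g, 0 ≤ β g)
    (hβ1 : ∀ x ∈ C'', ∀ k₀ : ↥(Subgroup.centralizer ({s} : Set ↥(arch (↥(maximalRealSubfield L)) L (IsCMField.complexConj L) 3 (Matrix.diagonal α)))), ∫ h : ↥(Subgroup.centralizer ({s} : Set ↥(arch (↥(maximalRealSubfield L)) L (IsCMField.complexConj L) 3 (Matrix.diagonal α)))), β (x * (k₀ : ↥(arch (↥(maximalRealSubfield L)) L (IsCMField.complexConj L) 3 (Matrix.diagonal α))) * (h : ↥(arch (↥(maximalRealSubfield L)) L (IsCMField.complexConj L) 3 (Matrix.diagonal α)))) ∂νM = 1)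
    (hCMx : ∀ᶠ x in 𝓝[>] (0 : ℝ), ∀ y' : ↥(arch (↥(maximalRealSubfield L)) L (IsCMField.complexConj L) 3 (Matrix.diagonal α)), y' * gprimeTorus L α (insert w S) (hcCayPt w 0 2 p + x • (Pi.single w (Pi.single 0 1 : Fin 3 → ℝ) : {w : InfinitePlace L // IsComplex w} → Fin 3 → ℝ)) * y'⁻¹ ∈ tsupport a' → y' ∈ C'' * ((Subgroup.centralizer ({s} : Set ↥(arch (↥(maximalRealSubfield L)) L (IsCMField.complexConj L) 3 (Matrix.diagonal α)))) : Set ↥(arch (↥(maximalRealSubfield L)) L (IsCMField.complexConj L) 3 (Matrix.diagonal α))))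
    (hintx : ∀ᶠ x in 𝓝[>] (0 : ℝ), Integrable (descConj (gprimeTorus L α (insert w S) (hcCayPt w 0 2 p + x • (Pi.single w (Pi.single 0 1 : Fin 3 → ℝ) : {w : InfinitePlace L // IsComplex w} → Fin 3 → ℝ))) (chartTorusG L α (insert w S)) (forall_mem_chartTorusG_comm L α (insert w S) _) a')
      (chartQuotientMeasureG L α ν' (insert w S)))
    {κβ : ℝ≥0}
    (hmapβ : (haveI := isHaarMeasure_chartHaarG L α (insert w S)
       haveI := isInvInvariant_chartHaarG L α (insert w S)
       haveI := isHaarMeasure_map_subgroupOfEquivOfLe_symm hT (chartHaarG L α (insert w S))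
       haveI := isInvInvariant_map_subgroupOfEquivOfLe_symm hT (chartHaarG L α (insert w S))
      Measure.map Ψβ (quotientMeasure ((chartTorusG L α (insert w S)).subgroupOf (Subgroup.centralizer ({s} : Set ↥(arch (↥(maximalRealSubfield L)) L (IsCMField.complexConj L) 3 (Matrix.diagonal α)))))
          (Measure.map (Subgroup.subgroupOfEquivOfLe hT).symm (chartHaarG L α (insert w S)))
          (isClosed_subgroupOf_of_isClosed _ _ (isClosed_chartTorusG L α (insert w S))) νM)) = κβ • μ₀')
    {C₂ : ℝ}
    (hA0 : (∀ (f : Matrix (Fin 2) (Fin 2) ℂ → ℂ), Continuous f → HasCompactSupport f → ∀ θ : ℝ,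
      Tendsto (fun x : ℝ => |Real.exp x - Real.exp (-x)| •
          ∫ y, descConj (⟨hypBlockGL x θ, hypBlockGL_mem_of_eq_over hJ x θ⟩ : ↥(unitaryGroupOfForm (starRingEnd ℂ) J)) (torusU (starRingEnd ℂ) J)
            (LineRing.forall_mem_torusU_comm (starRingEnd ℂ) J (hypBlockGL_mem_torusU hJ x θ))
            (fun g : ↥(unitaryGroupOfForm (starRingEnd ℂ) J) => f ((g : GL (Fin 2) ℂ) : Matrix (Fin 2) (Fin 2) ℂ)) y ∂μ₀')
        (𝓝[≠] 0)
        (𝓝 (C₂ • ((∫ q in Ioi (0 : ℝ) ×ˢ Ioc (0 : ℝ) (2 * π),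
              f ((!![(1 : ℂ), 1; 1, -1] : Matrix (Fin 2) (Fin 2) ℂ) *
                (Complex.exp ((θ : ℂ) * Complex.I) • (1 : Matrix (Fin 2) (Fin 2) ℂ) +
                  q.1 • Matrix.diagonal ![Complex.exp ((θ : ℂ) * Complex.I) * Complex.I, -(Complex.exp ((θ : ℂ) * Complex.I) * Complex.I)] +
                  q.1 • !![(0 : ℂ), -(Complex.exp ((θ : ℂ) * Complex.I) * Complex.I) * Complex.exp (-((q.2 : ℂ) * Complex.I));
                    (Complex.exp ((θ : ℂ) * Complex.I) * Complex.I) * Complex.exp ((q.2 : ℂ) * Complex.I), 0]) *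
                !![(1 / 2 : ℂ), 1 / 2; 1 / 2, -(1 / 2)])) +
            ∫ q in Ioi (0 : ℝ) ×ˢ Ioc (0 : ℝ) (2 * π),
              f ((!![(1 : ℂ), 1; 1, -1] : Matrix (Fin 2) (Fin 2) ℂ) *
                (Complex.exp ((θ : ℂ) * Complex.I) • (1 : Matrix (Fin 2) (Fin 2) ℂ) +
                  q.1 • Matrix.diagonal ![-(Complex.exp ((θ : ℂ) * Complex.I) * Complex.I), Complex.exp ((θ : ℂ) * Complex.I) * Complex.I] +
                  q.1 • !![(0 : ℂ), (Complex.exp ((θ : ℂ) * Complex.I) * Complex.I) * Complex.exp (-((q.2 : ℂ) * Complex.I));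
                    -(Complex.exp ((θ : ℂ) * Complex.I) * Complex.I) * Complex.exp ((q.2 : ℂ) * Complex.I), 0]) *
                !![(1 / 2 : ℂ), 1 / 2; 1 / 2, -(1 / 2)]))))))
    (f : Matrix (Fin 2) (Fin 2) ℂ → ℂ) (hf : Continuous f) (hfc : HasCompactSupport f)
    (hfF : ∀ g : ↥(unitaryGroupOfForm (starRingEnd ℂ) J), f ((g : GL (Fin 2) ℂ) : Matrix (Fin 2) (Fin 2) ℂ) = (fun m : ↥(Subgroup.centralizer ({s} : Set ↥(arch (↥(maximalRealSubfield L)) L (IsCMField.complexConj L) 3 (Matrix.diagonal α)))) => ∫ x', β x' • a' (x' * (m : ↥(arch (↥(maximalRealSubfield L)) L (IsCMField.complexConj L) 3 (Matrix.diagonal α))) * x'⁻¹) ∂ν') (eM.symm (g, r₀))) :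
    Tendsto (fun x : ℝ => ((|Real.exp x - Real.exp (-x)| : ℝ) : ℂ) * chartOrbG L α ν' (insert w S) a' (hcCayPt w 0 2 p + x • (Pi.single w (Pi.single 0 1 : Fin 3 → ℝ) : {w : InfinitePlace L // IsComplex w} → Fin 3 → ℝ))) (𝓝[>] (0 : ℝ))
      (𝓝 (((((haveI := isHaarMeasure_chartHaarG L α (insert w S); chartHaarG L α (insert w S) (chartBoxImgG L α (insert w S)))).toReal : ℂ) * ((κβ : ℝ) : ℂ)) *
        ((C₂ : ℂ) * ((∫ q in Ioi (0 : ℝ) ×ˢ Ioc (0 : ℝ) (2 * π),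
              f ((!![(1 : ℂ), 1; 1, -1] : Matrix (Fin 2) (Fin 2) ℂ) *
                (Complex.exp ((θ₀ : ℂ) * Complex.I) • (1 : Matrix (Fin 2) (Fin 2) ℂ) +
                  q.1 • Matrix.diagonal ![Complex.exp ((θ₀ : ℂ) * Complex.I) * Complex.I, -(Complex.exp ((θ₀ : ℂ) * Complex.I) * Complex.I)] +
                  q.1 • !![(0 : ℂ), -(Complex.exp ((θ₀ : ℂ) * Complex.I) * Complex.I) * Complex.exp (-((q.2 : ℂ) * Complex.I));
                    (Complex.exp ((θ₀ : ℂ) * Complex.I) * Complex.I) * Complex.exp ((q.2 : ℂ) * Complex.I), 0]) *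
                !![(1 / 2 : ℂ), 1 / 2; 1 / 2, -(1 / 2)])) +
            ∫ q in Ioi (0 : ℝ) ×ˢ Ioc (0 : ℝ) (2 * π),
              f ((!![(1 : ℂ), 1; 1, -1] : Matrix (Fin 2) (Fin 2) ℂ) *
                (Complex.exp ((θ₀ : ℂ) * Complex.I) • (1 : Matrix (Fin 2) (Fin 2) ℂ) +
                  q.1 • Matrix.diagonal ![-(Complex.exp ((θ₀ : ℂ) * Complex.I) * Complex.I), Complex.exp ((θ₀ : ℂ) * Complex.I) * Complex.I] +
                  q.1 • !![(0 : ℂ), (Complex.exp ((θ₀ : ℂ) * Complex.I) * Complex.I) * Complex.exp (-((q.2 : ℂ) * Complex.I));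
                    -(Complex.exp ((θ₀ : ℂ) * Complex.I) * Complex.I) * Complex.exp ((q.2 : ℂ) * Complex.I), 0]) *
                !![(1 / 2 : ℂ), 1 / 2; 1 / 2, -(1 / 2)]))))) := by
  obtain ⟨fB, -, -, hfBdef, hblock⟩ := exists_block_testFunction_chartOrbG_xRay_eventuallyEq L α ν' a' S w p s hT hJ μ₀' eM Ψβ hΨβ θ₀ r₀ hγβ νM ha'c ha's hβc hβs hβ0 hβ1 hCMx hintx hmapβ
  refine tendsto_absSub_mul_chartOrbG_xRay_of_block_shared L α ν' a' S w p hJ μ₀' hA0 f hf hfc (fun g => ?_) θ₀ hblock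
  rw [hfF, hfBdef]

end SharedChart

section SharedNondeg

variable (L : Type) [Field L] [NumberField L] [IsCMField L] (α : Fin 3 → L)
  [MeasurableSpace ↥(arch (↥(maximalRealSubfield L)) L (IsCMField.complexConj L) 3 (Matrix.diagonal α))] [BorelSpace ↥(arch (↥(maximalRealSubfield L)) L (IsCMField.complexConj L) 3 (Matrix.diagonal α))]
  (ν' : Measure ↥(arch (↥(maximalRealSubfield L)) L (IsCMField.complexConj L) 3 (Matrix.diagonal α))) [ν'.IsHaarMeasure]
  (a' : ↥(arch (↥(maximalRealSubfield L)) L (IsCMField.complexConj L) 3 (Matrix.diagonal α)) → ℂ) (s : ↥(arch (↥(maximalRealSubfield L)) L (IsCMField.complexConj L) 3 (Matrix.diagonal α)))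
  {J : Matrix (Fin 2) (Fin 2) ℂ} (hJ : J = (StdForm.antidiagonal 2).over ℂ)
  [MeasurableSpace ↥(unitaryGroupOfForm (starRingEnd ℂ) J)] [BorelSpace ↥(unitaryGroupOfForm (starRingEnd ℂ) J)]
  [MeasurableSpace (↥(unitaryGroupOfForm (starRingEnd ℂ) J) ⧸ torusU (starRingEnd ℂ) J)] [BorelSpace (↥(unitaryGroupOfForm (starRingEnd ℂ) J) ⧸ torusU (starRingEnd ℂ) J)]
  (μ₀' : Measure (↥(unitaryGroupOfForm (starRingEnd ℂ) J) ⧸ torusU (starRingEnd ℂ) J))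
  [SMulInvariantMeasure ↥(unitaryGroupOfForm (starRingEnd ℂ) J) (↥(unitaryGroupOfForm (starRingEnd ℂ) J) ⧸ torusU (starRingEnd ℂ) J) μ₀'] [IsFiniteMeasureOnCompacts μ₀']
  {R : Type*} [Group R] [TopologicalSpace R]
  (eM : ↥(Subgroup.centralizer ({s} : Set ↥(arch (↥(maximalRealSubfield L)) L (IsCMField.complexConj L) 3 (Matrix.diagonal α)))) ≃ₜ* ↥(unitaryGroupOfForm (starRingEnd ℂ) J) × R) (θ₀ : ℝ) (r₀ : R)

include hJ in
/-- **`hΛ` IN THE SHARED CURRENCY — THE `x`-RAY LIMIT VALUE `K₀ · (C₂ · (cone⁺ + cone⁻)(f, θ₀))` IS NON-ZERO** for the block test function `f_B = (a′)_M^β ∘ eM⁻¹(·, r₀)` of a REAL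
NON-NEGATIVE test function `a′` POSITIVE AT THE WALL POINT `s` (★ (N1′)), its ambient extension `f` (`hfF`), the SHARED non-zero invariant Radon measure `μ₀′` (`hμ₀′`; ★
`ne_zero_of_sharedLink`) and the SHARED (A0) text `hA0`: the (A0) limit of `f_B` exists and is non-zero for EVERY such measure (★ ED. 3 currency-free
`ne_zero_of_tendsto_abs_sub_smul_integral_descConj_hypBlockGL_of_re_nonneg`), and `hA0 f` names its value — so `C₂ • (cone⁺ + cone⁻)(f, θ₀) ≠ 0` by uniqueness of limits; times
`K₀ ≠ 0`.  Positivity inputs as in §4 (★ `re_integral_conj_nonneg` ∕ `im_integral_conj_eq_zero` ∕ `re_integral_conj_pos_of_comm`, `hvert`).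
[cite: Shelstad1979, Lemma 4.3 (p. 25); Prop. 4.5 (p. 26)] [cite: Varadarajan1989, §6.4 Thm 23] [cite: Rogawski1990, §4.12 Lemma 4.12.1 p. 66; §8.2 p. 122] -/
theorem mul_sharedCone_blockTestFunction_ne_zero (hμ₀' : μ₀' ≠ 0)
    (hvert : ((eM.symm ((⟨hypBlockGL 0 θ₀, hypBlockGL_mem_of_eq_over hJ 0 θ₀⟩ : ↥(unitaryGroupOfForm (starRingEnd ℂ) J)), r₀) : ↥(Subgroup.centralizer ({s} : Set ↥(arch (↥(maximalRealSubfield L)) L (IsCMField.complexConj L) 3 (Matrix.diagonal α))))) : ↥(arch (↥(maximalRealSubfield L)) L (IsCMField.complexConj L) 3 (Matrix.diagonal α))) = s)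
    {β : ↥(arch (↥(maximalRealSubfield L)) L (IsCMField.complexConj L) 3 (Matrix.diagonal α)) → ℝ} (hβc : Continuous β) (hβs : HasCompactSupport β) (hβ0 : ∀ g, 0 ≤ β g) (hβpos : ∃ h₀ : ↥(Subgroup.centralizer ({s} : Set ↥(arch (↥(maximalRealSubfield L)) L (IsCMField.complexConj L) 3 (Matrix.diagonal α)))), 0 < β (h₀ : ↥(arch (↥(maximalRealSubfield L)) L (IsCMField.complexConj L) 3 (Matrix.diagonal α))))
    (ha'c : Continuous a') (ha's : HasCompactSupport a') (ha'0 : ∀ g, 0 ≤ (a' g).re ∧ (a' g).im = 0) (ha'pos : 0 < (a' s).re)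
    {C₂ : ℝ}
    (hA0 : (∀ (f : Matrix (Fin 2) (Fin 2) ℂ → ℂ), Continuous f → HasCompactSupport f → ∀ θ : ℝ,
      Tendsto (fun x : ℝ => |Real.exp x - Real.exp (-x)| •
          ∫ y, descConj (⟨hypBlockGL x θ, hypBlockGL_mem_of_eq_over hJ x θ⟩ : ↥(unitaryGroupOfForm (starRingEnd ℂ) J)) (torusU (starRingEnd ℂ) J)
            (LineRing.forall_mem_torusU_comm (starRingEnd ℂ) J (hypBlockGL_mem_torusU hJ x θ))
            (fun g : ↥(unitaryGroupOfForm (starRingEnd ℂ) J) => f ((g : GL (Fin 2) ℂ) : Matrix (Fin 2) (Fin 2) ℂ)) y ∂μ₀')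
        (𝓝[≠] 0)
        (𝓝 (C₂ • ((∫ q in Ioi (0 : ℝ) ×ˢ Ioc (0 : ℝ) (2 * π),
              f ((!![(1 : ℂ), 1; 1, -1] : Matrix (Fin 2) (Fin 2) ℂ) *
                (Complex.exp ((θ : ℂ) * Complex.I) • (1 : Matrix (Fin 2) (Fin 2) ℂ) +
                  q.1 • Matrix.diagonal ![Complex.exp ((θ : ℂ) * Complex.I) * Complex.I, -(Complex.exp ((θ : ℂ) * Complex.I) * Complex.I)] +
                  q.1 • !![(0 : ℂ), -(Complex.exp ((θ : ℂ) * Complex.I) * Complex.I) * Complex.exp (-((q.2 : ℂ) * Complex.I));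
                    (Complex.exp ((θ : ℂ) * Complex.I) * Complex.I) * Complex.exp ((q.2 : ℂ) * Complex.I), 0]) *
                !![(1 / 2 : ℂ), 1 / 2; 1 / 2, -(1 / 2)])) +
            ∫ q in Ioi (0 : ℝ) ×ˢ Ioc (0 : ℝ) (2 * π),
              f ((!![(1 : ℂ), 1; 1, -1] : Matrix (Fin 2) (Fin 2) ℂ) *
                (Complex.exp ((θ : ℂ) * Complex.I) • (1 : Matrix (Fin 2) (Fin 2) ℂ) +
                  q.1 • Matrix.diagonal ![-(Complex.exp ((θ : ℂ) * Complex.I) * Complex.I), Complex.exp ((θ : ℂ) * Complex.I) * Complex.I] +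
                  q.1 • !![(0 : ℂ), (Complex.exp ((θ : ℂ) * Complex.I) * Complex.I) * Complex.exp (-((q.2 : ℂ) * Complex.I));
                    -(Complex.exp ((θ : ℂ) * Complex.I) * Complex.I) * Complex.exp ((q.2 : ℂ) * Complex.I), 0]) *
                !![(1 / 2 : ℂ), 1 / 2; 1 / 2, -(1 / 2)]))))))
    (f : Matrix (Fin 2) (Fin 2) ℂ → ℂ) (hf : Continuous f) (hfc : HasCompactSupport f)
    (hfF : ∀ g : ↥(unitaryGroupOfForm (starRingEnd ℂ) J), f ((g : GL (Fin 2) ℂ) : Matrix (Fin 2) (Fin 2) ℂ) = (fun m : ↥(Subgroup.centralizer ({s} : Set ↥(arch (↥(maximalRealSubfield L)) L (IsCMField.complexConj L) 3 (Matrix.diagonal α)))) => ∫ x', β x' • a' (x' * (m : ↥(arch (↥(maximalRealSubfield L)) L (IsCMField.complexConj L) 3 (Matrix.diagonal α))) * x'⁻¹) ∂ν') (eM.symm (g, r₀)))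
    {K₀ : ℂ} (hK₀ : K₀ ≠ 0) :
    K₀ * ((C₂ : ℂ) * ((∫ q in Ioi (0 : ℝ) ×ˢ Ioc (0 : ℝ) (2 * π),
              f ((!![(1 : ℂ), 1; 1, -1] : Matrix (Fin 2) (Fin 2) ℂ) *
                (Complex.exp ((θ₀ : ℂ) * Complex.I) • (1 : Matrix (Fin 2) (Fin 2) ℂ) +
                  q.1 • Matrix.diagonal ![Complex.exp ((θ₀ : ℂ) * Complex.I) * Complex.I, -(Complex.exp ((θ₀ : ℂ) * Complex.I) * Complex.I)] +
                  q.1 • !![(0 : ℂ), -(Complex.exp ((θ₀ : ℂ) * Complex.I) * Complex.I) * Complex.exp (-((q.2 : ℂ) * Complex.I));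
                    (Complex.exp ((θ₀ : ℂ) * Complex.I) * Complex.I) * Complex.exp ((q.2 : ℂ) * Complex.I), 0]) *
                !![(1 / 2 : ℂ), 1 / 2; 1 / 2, -(1 / 2)])) +
            ∫ q in Ioi (0 : ℝ) ×ˢ Ioc (0 : ℝ) (2 * π),
              f ((!![(1 : ℂ), 1; 1, -1] : Matrix (Fin 2) (Fin 2) ℂ) *
                (Complex.exp ((θ₀ : ℂ) * Complex.I) • (1 : Matrix (Fin 2) (Fin 2) ℂ) +
                  q.1 • Matrix.diagonal ![-(Complex.exp ((θ₀ : ℂ) * Complex.I) * Complex.I), Complex.exp ((θ₀ : ℂ) * Complex.I) * Complex.I] +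
                  q.1 • !![(0 : ℂ), (Complex.exp ((θ₀ : ℂ) * Complex.I) * Complex.I) * Complex.exp (-((q.2 : ℂ) * Complex.I));
                    -(Complex.exp ((θ₀ : ℂ) * Complex.I) * Complex.I) * Complex.exp ((q.2 : ℂ) * Complex.I), 0]) *
                !![(1 / 2 : ℂ), 1 / 2; 1 / 2, -(1 / 2)]))) ≠ 0 := by
  haveI : Fact (0 < 2 * π) := ⟨by positivity⟩
  have hM' : IsClosed ((Subgroup.centralizer ({s} : Set ↥(arch (↥(maximalRealSubfield L)) L (IsCMField.complexConj L) 3 (Matrix.diagonal α)))) : Set ↥(arch (↥(maximalRealSubfield L)) L (IsCMField.complexConj L) 3 (Matrix.diagonal α))) := isClosed_centralizer_singleton_of_t2 _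
  -- `ψ = (a′)_M^β` on `Z(s)`: continuous, compactly supported, real non-negative, positive at `s`
  have hψ : Continuous (fun m : ↥(Subgroup.centralizer ({s} : Set ↥(arch (↥(maximalRealSubfield L)) L (IsCMField.complexConj L) 3 (Matrix.diagonal α)))) => ∫ x', β x' • a' (x' * (m : ↥(arch (↥(maximalRealSubfield L)) L (IsCMField.complexConj L) 3 (Matrix.diagonal α))) * x'⁻¹) ∂ν') :=
    continuous_integral_conj_subtype ν' _ hβc hβs ha'c
  have hψc : HasCompactSupport (fun m : ↥(Subgroup.centralizer ({s} : Set ↥(arch (↥(maximalRealSubfield L)) L (IsCMField.complexConj L) 3 (Matrix.diagonal α)))) => ∫ x', β x' • a' (x' * (m : ↥(arch (↥(maximalRealSubfield L)) L (IsCMField.complexConj L) 3 (Matrix.diagonal α))) * x'⁻¹) ∂ν') :=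
    hasCompactSupport_integral_conj ν' _ hM' hβs ha's
  have hψ0 : ∀ m : ↥(Subgroup.centralizer ({s} : Set ↥(arch (↥(maximalRealSubfield L)) L (IsCMField.complexConj L) 3 (Matrix.diagonal α)))), 0 ≤ (∫ x', β x' • a' (x' * (m : ↥(arch (↥(maximalRealSubfield L)) L (IsCMField.complexConj L) 3 (Matrix.diagonal α))) * x'⁻¹) ∂ν').re ∧ (∫ x', β x' • a' (x' * (m : ↥(arch (↥(maximalRealSubfield L)) L (IsCMField.complexConj L) 3 (Matrix.diagonal α))) * x'⁻¹) ∂ν').im = 0 :=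
    fun m => ⟨re_integral_conj_nonneg ν' hβ0 ha'0 (m : ↥(arch (↥(maximalRealSubfield L)) L (IsCMField.complexConj L) 3 (Matrix.diagonal α))), im_integral_conj_eq_zero ν' β ha'0 (m : ↥(arch (↥(maximalRealSubfield L)) L (IsCMField.complexConj L) 3 (Matrix.diagonal α)))⟩
  -- the block test function `f_B = ψ ∘ eM⁻¹(·, r₀)` and its ambient reading through `f`
  have hFc : Continuous fun b : ↥(unitaryGroupOfForm (starRingEnd ℂ) J) => (fun m : ↥(Subgroup.centralizer ({s} : Set ↥(arch (↥(maximalRealSubfield L)) L (IsCMField.complexConj L) 3 (Matrix.diagonal α)))) => ∫ x', β x' • a' (x' * (m : ↥(arch (↥(maximalRealSubfield L)) L (IsCMField.complexConj L) 3 (Matrix.diagonal α))) * x'⁻¹) ∂ν') (eM.symm (b, r₀)) := continuous_comp_symm_prodMk eM hψ r₀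
  have hFs : HasCompactSupport fun b : ↥(unitaryGroupOfForm (starRingEnd ℂ) J) => (fun m : ↥(Subgroup.centralizer ({s} : Set ↥(arch (↥(maximalRealSubfield L)) L (IsCMField.complexConj L) 3 (Matrix.diagonal α)))) => ∫ x', β x' • a' (x' * (m : ↥(arch (↥(maximalRealSubfield L)) L (IsCMField.complexConj L) 3 (Matrix.diagonal α))) * x'⁻¹) ∂ν') (eM.symm (b, r₀)) := hasCompactSupport_comp_symm_prodMk eM hψc r₀
  have hF0 : ∀ b : ↥(unitaryGroupOfForm (starRingEnd ℂ) J), 0 ≤ ((fun m : ↥(Subgroup.centralizer ({s} : Set ↥(arch (↥(maximalRealSubfield L)) L (IsCMField.complexConj L) 3 (Matrix.diagonal α)))) => ∫ x', β x' • a' (x' * (m : ↥(arch (↥(maximalRealSubfield L)) L (IsCMField.complexConj L) 3 (Matrix.diagonal α))) * x'⁻¹) ∂ν') (eM.symm (b, r₀))).re ∧ ((fun m : ↥(Subgroup.centralizer ({s} : Set ↥(arch (↥(maximalRealSubfield L)) L (IsCMField.complexConj L) 3 (Matrix.diagonal α)))) => ∫ x', β x' • a' (x' * (m : ↥(arch (↥(maximalRealSubfield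 L)) L (IsCMField.complexConj L) 3 (Matrix.diagonal α))) * x'⁻¹) ∂ν') (eM.symm (b, r₀))).im = 0 := fun b => hψ0 _
  -- positivity at the vertex: `eM⁻¹(e^{iθ₀}·1, r₀) = s` is central in `Z(s)`
  obtain ⟨h₀, hh₀⟩ := hβpos
  have hcomm : (h₀ : ↥(arch (↥(maximalRealSubfield L)) L (IsCMField.complexConj L) 3 (Matrix.diagonal α))) * s = s * (h₀ : ↥(arch (↥(maximalRealSubfield L)) L (IsCMField.complexConj L) 3 (Matrix.diagonal α))) := Subgroup.mem_centralizer_singleton_iff.1 h₀.2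
  have hpos : 0 < ((fun m : ↥(Subgroup.centralizer ({s} : Set ↥(arch (↥(maximalRealSubfield L)) L (IsCMField.complexConj L) 3 (Matrix.diagonal α)))) => ∫ x', β x' • a' (x' * (m : ↥(arch (↥(maximalRealSubfield L)) L (IsCMField.complexConj L) 3 (Matrix.diagonal α))) * x'⁻¹) ∂ν') (eM.symm ((⟨hypBlockGL 0 θ₀, hypBlockGL_mem_of_eq_over hJ 0 θ₀⟩ : ↥(unitaryGroupOfForm (starRingEnd ℂ) J)), r₀))).re := by
    show 0 < (∫ x', β x' • a' (x' * ((eM.symm ((⟨hypBlockGL 0 θ₀, hypBlockGL_mem_of_eq_over hJ 0 θ₀⟩ : ↥(unitaryGroupOfForm (starRingEnd ℂ) J)), r₀) : ↥(Subgroup.centralizer ({s} : Set ↥(arch (↥(maximalRealSubfield L)) L (IsCMField.complexConj L) 3 (Matrix.diagonal α))))) : ↥(arch (↥(maximalRealSubfield L)) L (IsCMField.complexConj L) 3 (Matrix.diagonal α))) * x'⁻¹) ∂ν').re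
    rw [hvert]
    exact re_integral_conj_pos_of_comm ν' hβc hβs hβ0 ha'c ha'0 hcomm hh₀ ha'pos
  -- the SHARED (A0) limit of `f ∘ coe = f_B` is the stated value; the (A0) limit of `f_B` is non-zero for every non-zero invariant Radon `μ₀′`
  have hA := hA0 f hf hfc θ₀
  have hfun : (fun g : ↥(unitaryGroupOfForm (starRingEnd ℂ) J) => f ((g : GL (Fin 2) ℂ) : Matrix (Fin 2) (Fin 2) ℂ)) = fun b : ↥(unitaryGroupOfForm (starRingEnd ℂ) J) => (fun m : ↥(Subgroup.centralizer ({s} : Set ↥(arch (↥(maximalRealSubfield L)) L (IsCMField.complexConj L) 3 (Matrix.diagonal α)))) => ∫ x', β x' • a' (x' * (m : ↥(arch (↥(maximalRealSubfield L)) L (IsCMField.complexConj L) 3 (Matrix.diagonal α))) * x'⁻¹) ∂ν') (eM.symm (b, r₀)) := funext hfF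
  rw [hfun] at hA
  have hne := ne_zero_of_tendsto_abs_sub_smul_integral_descConj_hypBlockGL_of_re_nonneg hJ μ₀' hμ₀' hFc hFs hF0 θ₀ hpos le_rfl hA
  rw [Complex.real_smul] at hne
  exact mul_ne_zero hK₀ hne

end SharedNondeg

end Literature.NumberTheory.Rogawski1990

end
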